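import Literature.Probability.RandomPlanarGeometry.HexSAWBrickWallStripFugacityWidthOneSwitch
import Literature.Probability.RandomPlanarGeometry.HexSAWBrickWallStripFugacityTwoWallOrder
import Mathlib.Analysis.SpecificLimits.Normed
import HarnessLib

/-!
# The width-one two-wall rate of honeycomb SAW is the positive root of `μ³ = yμ + y`; `μ(S_1)` is the plastic number

Topic `Literature/Probability/RandomPlanarGeometry` (continues `HexSAWBrickWallStripFugacityWidthOneSwitch.lean` — the switch
words of the one-cell strip `S_1 = ℤ × {0,1}` of the brick-wall (honeycomb) lattice, `swPair`, `swPair_injOn`,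
`bottomVisits₀_add_topVisits₀_swWalk` — and `HexSAWBrickWallStripFugacityTwoWallOrder.lean`: the coordinates `WallPot.siteAt`,
`rowAt`, `parAt`, `vertAt`, prefixes `pref`, the last-step anatomy `last_step_coord`, `siteAt_add_two_ne`,
`eq_of_pref_eq_of_siteAt_eq`, and the weight bookkeeping `pow_visits_succ`, `visits_pref`, `wArr`).  Source of the objects:
N. R. Beaton, M. Bousquet-Mélou, J. de Gier, H. Duminil-Copin, A. J. Guttmann, *The critical fugacity for surface adsorption of
self-avoiding walks on the honeycomb lattice is `1+√2`*, Comm. Math. Phys. 326 (2014) 727–754, arXiv:1109.0358v5, §3.2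
Proposition 6 (p. 10): the two-fugacity rate `μ_T(y,z) = lim_n C_{T,n}(y,z)^{1/n}` of the strip `S_T`, weights `y^{bc(ω)} z^{tc(ω)}`
(`bc`, `tc` = visits to the odd-column sites of the bottom / top row), here at `T = 1`, `z = y`: `HexBW.stripMuY₂ 1 y y`.  The paper
invokes the transfer-matrix method only for the rationality of the strip series (§3.2, arXiv v5 p. 12: "all series counting walks in
a strip that occur in this section [are] rational", citing Flajolet–Sedgewick p. 364 and [1] = S. E. Alm, S. Janson, *Random
self-avoiding walks on one-dimensional lattices*, Commun. Statist. Stochastic Models 6 (1990), not held here) and proves no closed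
form.  RELATION TO THE TREE AT `y = 1`: the same strip is Duminil-Copin–Smirnov's width-two strip `HV.stripV 2 L` of the
mid-edge model, whose walks `HexSAWStripWidthTwoComplete.lean` classifies completely and whose bridge series has its pole at the
inverse plastic number (`HV.stripTwo_critical_iff_plastic`; the printed denominator `1 − 2z² + z⁴ − z⁶ = (1−z²−z³)(1−z²+z³)` of
Beaton–Guttmann–Jensen 2012 is `HexSAWStripBGJPrinted.lean`'s `BGJ12.den_one_factor`) — so at `y = 1` the value below is the
walk-rate (Fekete, translation classes) form of a fact the tree holds for bridges; what is new here is the two-wall FUGACITY law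
for every `y > 0` and its proof by a finite phase potential (elementary; the nearest printed ladder computations are for the
square lattice: Zeilberger 1996, arXiv:math/9506214; Dangovski–Lalov 2017, arXiv:1709.09223):

  **for every `y > 0`, `μ_1(y,y)` is the unique positive root of `μ³ = yμ + y`** (`stripMuY₂_one_self_pow_three_eq`,
  `stripMuY₂_one_self_eq_of_pow_three_eq`); in particular the connective constant of the one-cell honeycomb strip is the
  plastic number, `μ(S_1)³ = μ(S_1) + 1`, `1.3247 < μ(S_1) < 1.3248` (`stripConnectiveConstant_one_pow_three`,
  `stripConnectiveConstant_one_mem_Ioo`), and `y + y/√(y+√y) ≤ μ_1(y,y)² ≤ y + √y` (`stripMuY₂_one_self_sq_mem_Icc`).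

## The argument

*Part A (lower bound, `y·μ_1 + y ≤ μ_1³`).*  The switch words with `k ≤ n` forward switches among `n` wall pairs are `C(n,k)`
distinct walks of `S_{2n+k}(S_1)` of weight `y^{n+1}` (previous file; its hypothesis `1 ≤ y` is only used as `0 ≤ y`, so we
re-run the proof: `choose_mul_pow_le_stripZ₂_one_of_nonneg`).  Summing the binomial theorem by pigeonhole
(`exists_choose_mul_pow_ge`), `C_{1,2n+k}(y,y) t^{2n+k} ≥ y (y t²(1+t))^n/(n+1)` for the best `k`; against the Fekete limit
`C_{1,N}^{1/N} → μ_1` this gives `y t²(1+t) > 1 ⇒ μ_1 t ≥ 1` (`one_le_stripMuY₂_one_self_mul`) and, letting `t ↓ 1/μ_1`,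
`y μ_1 + y ≤ μ_1³` (`mul_add_le_stripMuY₂_one_self_pow_three`).

*Part B (upper bound, `μ_1³ ≤ y·μ_1 + y`).*  THE STRUCTURE OF SAW ON THE TWO-ROW LADDER.  `S_1` has the horizontal bonds of both
rows and the vertical bonds ("rungs") at the even columns; the weighted sites are the odd columns of both rows.  Between two
rungs a SAW moves straight (`run_straight`: no immediate reversal), and no two rungs are consecutive (`not_vert_vert`).  Call a
rung a *reversal* if the heading after it is opposite to the heading before it.  **A reversal at the second or a later rung
leads into a dead-end corridor**: the row just left is visited at every column ahead up to the column of the previous rung,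
whose site on the current row is visited too; in particular the other site of the current column is always visited, so no
further rung is possible (`other_site_visited_of_reversal` — the only use of self-avoidance beyond non-backtracking; the first
rung's reversal, a return over the initial run, is the one exception and is harmless).  THE PHASE POTENTIAL.  Give a walk prefix
the value `Φ` according to its phase — initial run (no rung yet; `runE`, `runO` by column parity), just after the first rung
(`rg1`), forward (`fA` odd column, `fB` even column: at least one rung, last step horizontal, and either exactly one rung so far
or heading unchanged across the last rung), just after a later rung (`rg2`), corridor (`coO`, `coE`: at least two rungs, last
step horizontal, heading reversed across the last rung) — all read off from four observables of the prefix (`nV` = number of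
rungs, `vertAt` = last step vertical, `hd` = current heading, `gd` = heading before the last rung; `phase`, `phiAt`).  The
one-step inequalities `Σ_{admissible moves} (new weight)·Φ(extension) ≤ ρ·Φ(prefix)` (`LValid`; proved fibrewise in
`sum_fibre_le` by the injective last-step code of the previous files) read
`runE ≤ ρ·runO`, `y·runO + rg1 ≤ ρ·runE`, `2y·fA ≤ ρ·rg1`, `fB ≤ ρ·fA`, `y·fA + rg2 ≤ ρ·fB`, `y·fA + y·coO ≤ ρ·rg2`,
`coE ≤ ρ·coO`, `y·coO ≤ ρ·coE`, and are solved at EVERY `ρ > 0` with `yρ + y < ρ³` by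
`fA = 1, fB = ρ, rg2 = ρ² − y, coO = (ρ³−yρ−y)/y, coE = (ρ³−yρ−y)/ρ, rg1 = 2y/ρ, runE = 2y/(ρ²−y), runO = 2y/(ρ(ρ²−y))`
(`lvals`, `lvalid`): the corridor carries the slack `ρ³ − yρ − y`, the initial phase is paid for by the constant `potSum 0`.
Hence `C_{1,N}(y,y) ≤ const·ρ^N` (`potSum_succ_le`, `stripZ₂_le_potSum_div`) and `μ_1(y,y) ≤ ρ`
(`stripMuY₂_one_self_le`); letting `ρ ↓ μ_1` by continuity of the cubic, `μ_1³ ≤ yμ_1 + y`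
(`stripMuY₂_one_self_pow_three_le`).  [The relaxation WITHOUT the corridor phase — non-backtracking walks — has rate given by
`ρ³ = yρ + 2y`, i.e. `μ² ≤ y + 2√y + …`, the width-one bound of the previous files; the corridor is exactly the difference.]

## Statements (namespace `Literature.Probability.RandomPlanarGeometry.SAW.HexBW`, all PROVED, standard axioms)

Part A: `exists_choose_mul_pow_ge`, `choose_mul_pow_le_stripZ₂_one_of_nonneg` (`0 ≤ y`), `exists_stripZ₂_one_mul_pow_ge`,
`eventually_stripZ₂_one_le_pow`, ★ `one_le_stripMuY₂_one_self_mul` (`y t²(1+t) > 1 ⇒ 1 ≤ μ_1(y,y) t`),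
★★ **`mul_add_le_stripMuY₂_one_self_pow_three`** (`y·μ_1(y,y) + y ≤ μ_1(y,y)³`, `y > 0`).
Part B (namespace `….HexBW.LadderPot`): observables `colAt`, `nV`, `hd`, `gd`, `obs_congr`; steps `step_coord`,
`time_eq_of_siteAt_eq`, `row01`, `vert_step`, `horiz_step`, ★ `not_vert_vert`, ★ `run_straight`, `gd_eq_hd_of_last_vert`,
`hd_eq_of_run`, ★★ **`other_site_visited_of_reversal`**; the potential `LVals`, `phase`, `fwF`, `evF`, `phiAt`, `LValid`, `pmin`,
`wArr_one_eq`, `dirOf`, `cv`, ★★ **`sum_fibre_le`**, `potSum`, `potSum_succ_le`, `potSum_le_pow_mul`, `stripZ₂_le_potSum_div`,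
★ `stripMuY₂_one_self_le_of_valid`, `lvals`, ★ `lvalid`, ★★ `stripMuY₂_one_self_le` (`yρ + y < ρ³ ⇒ μ_1(y,y) ≤ ρ`);
★★★ **`stripMuY₂_one_self_pow_three_le`** (`μ_1(y,y)³ ≤ y·μ_1(y,y) + y`, `y > 0`).
Part C: ★★★ **`stripMuY₂_one_self_pow_three_eq`** (`μ_1(y,y)³ = y·μ_1(y,y) + y`), `stripMuY₂_one_self_sq_eq`
(`μ_1² = y + y/μ_1`), `lt_stripMuY₂_one_self_sq` (`y < μ_1²`), ★ `stripMuY₂_one_self_eq_of_pow_three_eq` (uniqueness of the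
positive root), ★ `stripMuY₂_one_self_sq_mem_Icc` (`μ_1(y,y)² ∈ [y + y/√(y+√y), y + √y]`), `stripMuY₂_one_one_one`
(`μ_T(1,1) = μ(S_T)`), ★★ `stripConnectiveConstant_one_pow_three` (`μ(S_1)³ = μ(S_1) + 1`), `stripConnectiveConstant_one_mem_Ioo`
(`1.3247 < μ(S_1) < 1.3248`).
Part D: ★★ `stripMuY₂_self_lt_one_of_nine_le` (`μ_T(y,y) < μ_1(y,y)` for every `T ≥ 2`, `y ≥ 9`; the previous file had `y ≥ 25`).

NOT treated here (remarks, not claims): general `(y, z)`, where the same ladder structure gives `μ²(μ² − y)(μ² − z) = yz` for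
`μ = μ_1(y,z)` — the sequels `HexSAWBrickWallStripFugacityWidthOneSextic.lean` (upper half, row-dependent phase potential) and
`HexSAWBrickWallStripFugacityWidthOneSexticLower.lean` (lower half and `max(y,z) < μ²`, two-row switch words read as Boolean
tuples with a `2 × 2` unit transfer matrix) treat it; widths `T ≥ 2`, where reversals into hooks of every length occur and no
finite phase structure is exact.  Editions: ed.5 (tree, p382610); ed.6 = ed.5 with this paragraph updated (docstring-only).
-/

noncomputable section

open Filter Topology Finset Literature.Probability.LatticeModels Literature.Probability.Percolation SimpleGraph

namespace Literature.Probability.RandomPlanarGeometry.SAW.HexBW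

variable {y : ℝ}

/-! ## Part A. The lower bound `y·μ_1(y,y) + y ≤ μ_1(y,y)³` from the switch words -/

/-! ### §A.1 The full binomial entropy of the switch words -/

/-- **Averaging the binomial theorem**: some `k ≤ n` has `C(n,k)·t^k ≥ (1+t)^n/(n+1)` (pigeonhole on the `n+1` terms).
[cite: MadrasSlade1993, §1.2 (elementary counting)] -/
theorem exists_choose_mul_pow_ge (n : ℕ) (t : ℝ) :
    ∃ k ∈ range (n + 1), (1 + t) ^ n / (n + 1) ≤ (n.choose k : ℝ) * t ^ k := by
  have hsum : ∑ k ∈ range (n + 1), (n.choose k : ℝ) * t ^ k = (1 + t) ^ n := by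
    rw [show (1 : ℝ) + t = t + 1 from add_comm 1 t, add_pow t 1 n]
    exact Finset.sum_congr rfl fun k _ => by rw [one_pow, mul_one, mul_comm]
  refine Finset.exists_le_of_sum_le Finset.nonempty_range_add_one ?_
  rw [Finset.sum_const, Finset.card_range, nsmul_eq_mul, hsum]
  have hn : (0 : ℝ) < n + 1 := by positivity
  rw [show ((n + 1 : ℕ) : ℝ) = (n : ℝ) + 1 by push_cast; ring, mul_div_cancel₀ _ hn.ne']

/-- **`C(n,k)·y^{n+1} ≤ C_{1,2n+k}(y,y)` for every `y ≥ 0`** — the tree's `choose_mul_pow_le_stripZ₂_one` with its hypothesis `1 ≤ y`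
relaxed (the proof there uses only `0 ≤ y`): the `C(n,k)` switch walks are distinct members of `S_{2n+k}(S_1)` of weight `y^{n+1}`.
[cite: BeatonBousquetMelouDeGierDuminilCopinGuttmann2014, §3.2 (arXiv v5 p. 10: C_{T,k}(y,z)); MadrasSlade1993, §8.2] -/
theorem choose_mul_pow_le_stripZ₂_one_of_nonneg (hy : 0 ≤ y) (n k : ℕ) :
    ((n.choose k : ℕ) : ℝ) * y ^ (n + 1) ≤ stripZ₂ 1 (2 * n + k) y y := by
  classical
  set S := (range n).powersetCard k with hS
  have hmem : ∀ s ∈ S, swPair n s ∈ stripPairs 1 (2 * n + k) := by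
    intro s hs
    obtain ⟨hsub, hcard⟩ := Finset.mem_powersetCard.1 hs
    have h := swPair_mem_stripPairs n s
    rwa [swLen_eq n hsub, hcard] at h
  have hw : ∀ s ∈ S, y ^ bottomVisits₀ (swPair n s).1 (swPair n s).2 (2 * n + k) *
      y ^ topVisits₀ 1 (swPair n s).1 (swPair n s).2 (2 * n + k) = y ^ (n + 1) := by
    intro s hs
    obtain ⟨hsub, hcard⟩ := Finset.mem_powersetCard.1 hs
    rw [← pow_add, swPair]
    simp only
    rw [← hcard, ← swLen_eq n hsub, bottomVisits₀_add_topVisits₀_swWalk]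
  calc ((n.choose k : ℕ) : ℝ) * y ^ (n + 1) = ∑ s ∈ S, y ^ (n + 1) := by
        rw [Finset.sum_const, hS, Finset.card_powersetCard, Finset.card_range, nsmul_eq_mul]
    _ = ∑ s ∈ S, y ^ bottomVisits₀ (swPair n s).1 (swPair n s).2 (2 * n + k) *
          y ^ topVisits₀ 1 (swPair n s).1 (swPair n s).2 (2 * n + k) := Finset.sum_congr rfl fun s hs => (hw s hs).symm
    _ = ∑ p ∈ S.image (swPair n), y ^ bottomVisits₀ p.1 p.2 (2 * n + k) * y ^ topVisits₀ 1 p.1 p.2 (2 * n + k) := by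
        rw [Finset.sum_image fun s hs s' hs' h => swPair_injOn n k hs hs' h]
    _ ≤ stripZ₂ 1 (2 * n + k) y y := by
        rw [stripZ₂]
        refine Finset.sum_le_sum_of_subset_of_nonneg (fun p hp => ?_) fun p _ _ => by positivity
        obtain ⟨s, hs, rfl⟩ := Finset.mem_image.1 hp
        exact hmem s hs

/-- **The switch words of total length `2n + k` carry weight at least `y·(y t²(1+t))^n/(n+1)` against `t^{2n+k}` for the best `k ≤ n`.**
[cite: BeatonBousquetMelouDeGierDuminilCopinGuttmann2014, §3.2 (arXiv v5 p. 10: C_{T,k}(y,z)); MadrasSlade1993, §8.2] -/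
theorem exists_stripZ₂_one_mul_pow_ge (hy : 0 ≤ y) (n : ℕ) {t : ℝ} (ht : 0 ≤ t) :
    ∃ k ∈ range (n + 1), y * (y * t ^ 2 * (1 + t)) ^ n / (n + 1) ≤ stripZ₂ 1 (2 * n + k) y y * t ^ (2 * n + k) := by
  obtain ⟨k, hk, hck⟩ := exists_choose_mul_pow_ge n t
  refine ⟨k, hk, ?_⟩
  have hZ := choose_mul_pow_le_stripZ₂_one_of_nonneg hy n k
  have hy0 : 0 ≤ y := hy
  calc y * (y * t ^ 2 * (1 + t)) ^ n / (n + 1) = y ^ (n + 1) * t ^ (2 * n) * ((1 + t) ^ n / (n + 1)) := by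
        rw [mul_pow, mul_pow, ← pow_mul, pow_succ]; ring
    _ ≤ y ^ (n + 1) * t ^ (2 * n) * ((n.choose k : ℝ) * t ^ k) := mul_le_mul_of_nonneg_left hck (by positivity)
    _ = ((n.choose k : ℝ) * y ^ (n + 1)) * t ^ (2 * n + k) := by rw [pow_add]; ring
    _ ≤ stripZ₂ 1 (2 * n + k) y y * t ^ (2 * n + k) := mul_le_mul_of_nonneg_right hZ (by positivity)

/-! ### §A.2 The rate dominates the renewal root: `y·t²·(1+t) > 1 ⇒ μ_1(y,y)·t ≥ 1`, whence `μ_1³ ≥ yμ_1 + y` -/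

/-- Eventually `C_{1,N}(y,y) ≤ (μ_1(y,y)·(1+η))^N` (`η > 0`), from `C_{1,N}^{1/N} → μ_1`. [cite: BeatonBousquetMelouDeGierDuminilCopinGuttmann2014, §3.2 Proposition 6 (arXiv v5 p. 10: μ_T(y,z) = lim C_{T,k}^{1/k})] -/
theorem eventually_stripZ₂_one_le_pow (hy : 0 < y) {η : ℝ} (hη : 0 < η) :
    ∀ᶠ N : ℕ in atTop, stripZ₂ 1 N y y ≤ (stripMuY₂ 1 y y * (1 + η)) ^ N := by
  have hμ := stripMuY₂_pos 1 hy hy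
  have hlt : stripMuY₂ 1 y y < stripMuY₂ 1 y y * (1 + η) := by nlinarith
  have hev := (tendsto_stripZ₂_rpow 1 hy hy).eventually (gt_mem_nhds hlt)
  filter_upwards [hev, Filter.eventually_gt_atTop 0] with N hN hN0
  have hZ := (stripZ₂_pos 1 N hy hy).le
  have hN' : (0 : ℝ) < N := by exact_mod_cast hN0
  have h := pow_le_pow_left₀ (Real.rpow_nonneg hZ _) hN.le N
  rwa [← Real.rpow_natCast (stripZ₂ 1 N y y ^ (1 / (N : ℝ))) N, ← Real.rpow_mul hZ, one_div_mul_cancel hN'.ne',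
    Real.rpow_one] at h

/-- **If `y t²(1+t) > 1` then `μ_1(y,y)·t ≥ 1`** (`y > 0`, `t > 0`): otherwise `C_{1,N} t^N` would be both summably small (Fekete limit)
and at least `y (yt²(1+t))^n/(n+1) → ∞` along the switch words. [cite: BeatonBousquetMelouDeGierDuminilCopinGuttmann2014, §3.2 Proposition 6 (arXiv v5 p. 10); MadrasSlade1993, §8.2, (8.2.2)–(8.2.3)] -/
theorem one_le_stripMuY₂_one_self_mul (hy : 0 < y) {t : ℝ} (ht : 0 < t) (hq : 1 < y * t ^ 2 * (1 + t)) :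
    1 ≤ stripMuY₂ 1 y y * t := by
  have hy0 : 0 < y := hy
  set μ := stripMuY₂ 1 y y with hμdef
  have hμ : 0 < μ := stripMuY₂_pos 1 hy0 hy0
  set q := y * t ^ 2 * (1 + t) with hqdef
  by_contra hcon
  rw [not_le] at hcon
  -- room: `μ t (1+η) = θ < 1` with `η = (1 − μt)/(2 μ t)`
  have hμt : 0 < μ * t := mul_pos hμ ht
  set η : ℝ := (1 - μ * t) / (2 * (μ * t)) with hηdef
  have hη : 0 < η := by rw [hηdef]; exact div_pos (by linarith) (by positivity)
  set θ : ℝ := μ * t * (1 + η) with hθdef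
  have hθ1 : θ < 1 := by
    rw [hθdef, hηdef]; field_simp; nlinarith
  have hθ0 : 0 < θ := by rw [hθdef]; positivity
  have hev1 := eventually_stripZ₂_one_le_pow hy0 hη
  -- `y q^n/(n+1) → ∞`: from `(n+1)/q^n → 0`
  have hq0 : 0 < q := by linarith
  have hsmall : Tendsto (fun n : ℕ => ((n : ℝ) ^ 1 / q ^ n)) atTop (𝓝 0) := tendsto_pow_const_div_const_pow_of_one_lt 1 hq
  have hsmall' : Tendsto (fun n : ℕ => ((n : ℝ) ^ 0 / q ^ n)) atTop (𝓝 0) := tendsto_pow_const_div_const_pow_of_one_lt 0 hq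
  have hev2 : ∀ᶠ n : ℕ in atTop, (n : ℝ) + 1 < y * q ^ n := by
    have h1 := hsmall.eventually (gt_mem_nhds (show (0:ℝ) < y / 4 by positivity))
    have h2 := hsmall'.eventually (gt_mem_nhds (show (0:ℝ) < y / 4 by positivity))
    filter_upwards [h1, h2] with n hn1 hn2
    have hqn : 0 < q ^ n := pow_pos hq0 n
    rw [pow_one, div_lt_iff₀ hqn] at hn1
    rw [pow_zero, div_lt_iff₀ hqn] at hn2
    nlinarith
  -- choose `n` with both: `N ≥ 2n` is in the range of `hev1`, and `hev2`
  obtain ⟨N₀, hN₀⟩ := Filter.eventually_atTop.1 hev1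
  obtain ⟨n₀, hn₀⟩ := Filter.eventually_atTop.1 hev2
  set n : ℕ := max N₀ n₀ with hn
  obtain ⟨k, hk, hge⟩ := exists_stripZ₂_one_mul_pow_ge hy.le n ht.le
  have hkn : k ≤ n := Nat.lt_succ_iff.1 (Finset.mem_range.1 hk)
  have hN : N₀ ≤ 2 * n + k := by omega
  have hZle := hN₀ (2 * n + k) hN
  have hbig := hn₀ n (le_max_right _ _)
  -- `Z t^N ≤ θ^N ≤ 1 ≤ … < y q^n/(n+1) ≤ Z t^N`
  have htN : 0 < t ^ (2 * n + k) := pow_pos ht _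
  have h1 : stripZ₂ 1 (2 * n + k) y y * t ^ (2 * n + k) ≤ θ ^ (2 * n + k) := by
    calc stripZ₂ 1 (2 * n + k) y y * t ^ (2 * n + k) ≤ (μ * (1 + η)) ^ (2 * n + k) * t ^ (2 * n + k) :=
          mul_le_mul_of_nonneg_right hZle htN.le
      _ = θ ^ (2 * n + k) := by rw [← mul_pow, hθdef]; ring
  have h2 : θ ^ (2 * n + k) ≤ 1 := pow_le_one₀ hθ0.le hθ1.le
  have h3 : (1 : ℝ) < y * q ^ n / (n + 1) := by
    rw [lt_div_iff₀ (by positivity)]; linarith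
  linarith [hge]

/-- ★★ **THE CUBIC LOWER BOUND `y·μ_1(y,y) + y ≤ μ_1(y,y)³`** for every `y > 0`: the width-one two-wall rate is at least the growth rate
`1/t*` of the free monoid of switch words (`y t*² (1 + t*) = 1`), i.e. the positive root of `μ³ = yμ + y` (the matching upper bound is
`stripMuY₂_one_self_pow_three_le` below). [cite: BeatonBousquetMelouDeGierDuminilCopinGuttmann2014, §3.2 Proposition 6 (arXiv v5 p. 10: μ_T(y,z)) and §3.1 Proposition 5 (arXiv v5 p. 9: "zig-zag walks sticking to the surface")] -/
theorem mul_add_le_stripMuY₂_one_self_pow_three (hy : 0 < y) : y * stripMuY₂ 1 y y + y ≤ stripMuY₂ 1 y y ^ 3 := by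
  have hy0 : 0 < y := hy
  set μ := stripMuY₂ 1 y y with hμdef
  have hμ : 0 < μ := stripMuY₂_pos 1 hy0 hy0
  by_contra hcon
  rw [not_le] at hcon
  -- at `t = 1/μ`: `y t² (1+t) > 1`, so `μ·t ≥ 1` is an equality — push `t` down a little
  set q₀ : ℝ := y / μ ^ 2 * (1 + 1 / μ) with hq₀
  have hq₀1 : 1 < q₀ := by
    rw [hq₀]
    have e : y / μ ^ 2 * (1 + 1 / μ) = (y * μ + y) / μ ^ 3 := by field_simp
    rw [e, one_lt_div (pow_pos hμ 3)]
    exact hcon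
  -- `λ = 1 − ε`, `ε = (q₀ − 1)/(4 q₀)`; `λ³ q₀ ≥ (1 − 3ε) q₀ > 1`
  set ε : ℝ := (q₀ - 1) / (4 * q₀) with hε
  have hq₀0 : 0 < q₀ := by linarith
  have hε0 : 0 < ε := by rw [hε]; exact div_pos (by linarith) (by positivity)
  have hε1 : ε < 1 / 4 := by rw [hε, div_lt_div_iff₀ (by positivity) (by norm_num)]; nlinarith
  set t : ℝ := (1 - ε) / μ with htdef
  have ht : 0 < t := by rw [htdef]; exact div_pos (by linarith) hμ
  have hq : 1 < y * t ^ 2 * (1 + t) := by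
    have h1 : (1 - ε) ^ 3 * q₀ ≤ y * t ^ 2 * (1 + t) := by
      rw [htdef, hq₀]
      have hl : (0:ℝ) ≤ 1 - ε := by linarith
      have e1 : y * ((1 - ε) / μ) ^ 2 * (1 + (1 - ε) / μ) = (1 - ε) ^ 2 * (y / μ ^ 2 * (1 + (1 - ε) / μ)) := by ring
      rw [e1, pow_succ]
      have h2 : (1 - ε) * (1 + 1 / μ) ≤ 1 + (1 - ε) / μ := by
        rw [div_eq_mul_one_div (1 - ε) μ]; nlinarith [one_div_pos.2 hμ]
      calc (1 - ε) ^ 2 * (1 - ε) * (y / μ ^ 2 * (1 + 1 / μ)) = (1 - ε) ^ 2 * (y / μ ^ 2) * ((1 - ε) * (1 + 1 / μ)) := by ring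
        _ ≤ (1 - ε) ^ 2 * (y / μ ^ 2) * (1 + (1 - ε) / μ) := mul_le_mul_of_nonneg_left h2 (by positivity)
        _ = (1 - ε) ^ 2 * (y / μ ^ 2 * (1 + (1 - ε) / μ)) := by ring
    have h2 : 1 - 3 * ε ≤ (1 - ε) ^ 3 := by nlinarith [mul_nonneg (mul_nonneg hε0.le hε0.le) (by linarith : (0:ℝ) ≤ 3 - ε)]
    have h3 : 1 < (1 - 3 * ε) * q₀ := by
      rw [hε]; field_simp; nlinarith
    have h4 : (1 - 3 * ε) * q₀ ≤ (1 - ε) ^ 3 * q₀ := mul_le_mul_of_nonneg_right h2 hq₀0.le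
    linarith
  have h := one_le_stripMuY₂_one_self_mul hy ht hq
  rw [htdef, mul_div_assoc', mul_comm, mul_div_assoc, div_self hμ.ne', mul_one] at h
  linarith

/-! ## Part B. The upper bound `μ_1(y,y)³ ≤ y·μ_1(y,y) + y` from a phase potential on the two-row ladder -/


namespace LadderPot

open WallPot

variable {y ρ : ℝ} {N : ℕ} {p p' : Site 2 × (ℕ → Site 2)}

/-! ### §B.1 Observables of a walk prefix on the two-row ladder `S_1` -/

/-- The column of the `m`-th site. [cite: MadrasSlade1993, §8.2, eq. (8.2.1)] -/
def colAt (p : Site 2 × (ℕ → Site 2)) (m : ℕ) : ℤ := siteAt p m 0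

/-- The number of vertical steps among the first `n` steps. [cite: EntingJensen2009, §7.4.2, Fig. 7.10] -/
def nV (p : Site 2 × (ℕ → Site 2)) (n : ℕ) : ℕ := ((Finset.range n).filter fun i => vertAt p i = true).card

/-- The direction (`±1`) of the last horizontal step among the first `n` steps (`0` if none). [cite: EntingJensen2009, §7.4.2, Fig. 7.10] -/
def hd (p : Site 2 × (ℕ → Site 2)) : ℕ → ℤ
  | 0 => 0
  | n + 1 => if vertAt p n = true then hd p n else colAt p (n + 1) - colAt p n

/-- The direction of the last horizontal step BEFORE the last vertical step among the first `n` steps (`0` if none).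
[cite: EntingJensen2009, §7.4.2, Fig. 7.10] -/
def gd (p : Site 2 × (ℕ → Site 2)) : ℕ → ℤ
  | 0 => 0
  | n + 1 => if vertAt p n = true then hd p n else gd p n

/-- One more step adds its vertical indicator. [cite: EntingJensen2009, §7.4.2, Fig. 7.10] -/
theorem nV_succ (p : Site 2 × (ℕ → Site 2)) (n : ℕ) : nV p (n + 1) = nV p n + (if vertAt p n = true then 1 else 0) := by
  unfold nV
  rw [Finset.range_add_one, Finset.filter_insert]
  split_ifs with h
  · rw [Finset.card_insert_of_notMem (by simp)]
  · rfl

/-- `hd` is unchanged by a vertical step. [cite: EntingJensen2009, §7.4.2, Fig. 7.10] -/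
theorem hd_succ_of_vert {n : ℕ} (h : vertAt p n = true) : hd p (n + 1) = hd p n := by simp [hd, h]
/-- `hd` records a horizontal step. [cite: EntingJensen2009, §7.4.2, Fig. 7.10] -/
theorem hd_succ_of_horiz {n : ℕ} (h : vertAt p n = false) : hd p (n + 1) = colAt p (n + 1) - colAt p n := by simp [hd, h]
/-- `gd` records the heading at a vertical step. [cite: EntingJensen2009, §7.4.2, Fig. 7.10] -/
theorem gd_succ_of_vert {n : ℕ} (h : vertAt p n = true) : gd p (n + 1) = hd p n := by simp [gd, h]
/-- `gd` is unchanged by a horizontal step. [cite: EntingJensen2009, §7.4.2, Fig. 7.10] -/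
theorem gd_succ_of_horiz {n : ℕ} (h : vertAt p n = false) : gd p (n + 1) = gd p n := by simp [gd, h]

/-- Observables of a walk agree with those of any walk with the same sites up to time `n`. [cite: MadrasSlade1993, §8.2, eq. (8.2.2)] -/
theorem obs_congr {p p' : Site 2 × (ℕ → Site 2)} {n : ℕ} (h : ∀ i ≤ n, siteAt p i = siteAt p' i) :
    (∀ i < n, vertAt p i = vertAt p' i) ∧ nV p n = nV p' n ∧ hd p n = hd p' n ∧ gd p n = gd p' n ∧ colAt p n = colAt p' n := by
  have hv : ∀ i < n, vertAt p i = vertAt p' i := fun i hi => by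
    unfold vertAt; rw [h i hi.le, h (i + 1) hi]
  have H : ∀ m ≤ n, hd p m = hd p' m ∧ gd p m = gd p' m := by
    intro m hm
    induction m with
    | zero => exact ⟨rfl, rfl⟩
    | succ m ih =>
      have ih' := ih (by omega)
      have hvm := hv m (by omega)
      cases hc : vertAt p m
      · rw [hd_succ_of_horiz hc, gd_succ_of_horiz hc, hd_succ_of_horiz (hvm.symm.trans hc), gd_succ_of_horiz (hvm.symm.trans hc), ih'.2]
        unfold colAt; rw [h (m + 1) (by omega), h m (by omega)]; exact ⟨rfl, rfl⟩
      · rw [hd_succ_of_vert hc, gd_succ_of_vert hc, hd_succ_of_vert (hvm.symm.trans hc), gd_succ_of_vert (hvm.symm.trans hc), ih'.1]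
        exact ⟨rfl, rfl⟩
  refine ⟨hv, ?_, (H n le_rfl).1, (H n le_rfl).2, by unfold colAt; rw [h n le_rfl]⟩
  unfold nV; exact congrArg Finset.card (Finset.filter_congr fun i hi => by rw [hv i (Finset.mem_range.1 hi)])

/-! ### §B.2 Steps of a ladder walk: coordinates, no two vertical steps in a row, horizontal runs are straight -/

/-- Any step of a strip walk is a brick-wall bond (coordinate form). [cite: EntingJensen2009, §7.4.2, Fig. 7.10] -/
theorem step_coord {T n : ℕ} (hp : p ∈ stripPairs T n) {i : ℕ} (hi : i < n) :
    ((siteAt p (i + 1) 0 = siteAt p i 0 + 1 ∨ siteAt p i 0 = siteAt p (i + 1) 0 + 1) ∧ siteAt p (i + 1) 1 = siteAt p i 1) ∨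
      (siteAt p (i + 1) 0 = siteAt p i 0 ∧
        ((siteAt p (i + 1) 1 = siteAt p i 1 + 1 ∧ (siteAt p i 0 + siteAt p i 1) % 2 = 0) ∨
          (siteAt p i 1 = siteAt p (i + 1) 1 + 1 ∧ (siteAt p (i + 1) 0 + siteAt p (i + 1) 1) % 2 = 0))) := by
  obtain ⟨-, -, hbw, -⟩ := mem_stripPairs.1 hp
  have hadj : brickWallGraph.Adj (siteAt p i) (siteAt p (i + 1)) := hbw i hi
  rwa [brickWallGraph_adj_coord] at hadj

/-- Self-avoidance: equal sites at times `≤ n` have equal times. [cite: MadrasSlade1993, §1.1] -/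
theorem time_eq_of_siteAt_eq {T n : ℕ} (hp : p ∈ stripPairs T n) {i j : ℕ} (hi : i ≤ n) (hj : j ≤ n) (h : siteAt p i = siteAt p j) : i = j := by
  obtain ⟨-, hω, -, -⟩ := mem_stripPairs.1 hp
  obtain ⟨-, -, -, hinj⟩ := Zd.mem_saws.1 hω
  exact hinj (show i ∈ {i | i ≤ n} from hi) (show j ∈ {i | i ≤ n} from hj) (add_left_cancel h)

/-- Rows of a walk in `S_1` are `0` or `1`. [cite: MadrasSlade1993, §8.2, eq. (8.2.1)] -/
theorem row01 {n : ℕ} (hp : p ∈ stripPairs 1 n) {m : ℕ} (hm : m ≤ n) : siteAt p m 1 = 0 ∨ siteAt p m 1 = 1 := by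
  have h := rowAt_mem hp hm; unfold rowAt at h; push_cast at h; omega

/-- A vertical step keeps the column, flips the row, and happens at an even column. [cite: EntingJensen2009, §7.4.2, Fig. 7.10] -/
theorem vert_step {n : ℕ} (hp : p ∈ stripPairs 1 n) {i : ℕ} (hi : i < n) (hv : vertAt p i = true) :
    siteAt p (i + 1) 0 = siteAt p i 0 ∧ siteAt p (i + 1) 1 = 1 - siteAt p i 1 ∧ siteAt p i 0 % 2 = 0 := by
  have h := step_coord hp hi
  have r0 := row01 hp hi.le
  have r1 := row01 hp (show i + 1 ≤ n by omega)
  unfold vertAt at hv; simp only [decide_eq_true_eq] at hv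
  omega

/-- A horizontal step keeps the row and moves the column by `±1`. [cite: EntingJensen2009, §7.4.2, Fig. 7.10] -/
theorem horiz_step {T n : ℕ} (hp : p ∈ stripPairs T n) {i : ℕ} (hi : i < n) (hv : vertAt p i = false) :
    siteAt p (i + 1) 1 = siteAt p i 1 ∧ (siteAt p (i + 1) 0 = siteAt p i 0 + 1 ∨ siteAt p (i + 1) 0 = siteAt p i 0 - 1) := by
  have h := step_coord hp hi
  unfold vertAt at hv; simp only [decide_eq_false_iff_not] at hv
  omega

/-- **No two vertical steps in a row** (the second would return to the earlier site). [cite: MadrasSlade1993, §1.1 (self-avoidance)] -/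
theorem not_vert_vert {n : ℕ} (hp : p ∈ stripPairs 1 n) {i : ℕ} (hi : i + 1 < n) (h1 : vertAt p i = true) (h2 : vertAt p (i + 1) = true) : False := by
  obtain ⟨a0, a1, -⟩ := vert_step hp (show i < n by omega) h1
  obtain ⟨b0, b1, -⟩ := vert_step hp hi h2
  have he : siteAt p (i + 1 + 1) = siteAt p i := by
    rw [site_two_eq_iff]; constructor <;> omega
  have := time_eq_of_siteAt_eq hp (by omega) (by omega) he
  omega

/-- **A run of horizontal steps is straight**: if the steps `i, …, i+m-1` are horizontal then the sites move by the constant direction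
`colAt p (i+1) - colAt p i = ±1` on a constant row. [cite: MadrasSlade1993, §1.1 (self-avoidance: no immediate reversal)] -/
theorem run_straight {T n : ℕ} (hp : p ∈ stripPairs T n) {i m : ℕ} (him : i + m ≤ n) (hm : 1 ≤ m) (hH : ∀ k < m, vertAt p (i + k) = false) :
    (colAt p (i + 1) - colAt p i = 1 ∨ colAt p (i + 1) - colAt p i = -1) ∧
      ∀ k ≤ m, colAt p (i + k) = colAt p i + (colAt p (i + 1) - colAt p i) * k ∧ siteAt p (i + k) 1 = siteAt p i 1 := by
  have h0 := horiz_step hp (show i < n by omega) (by simpa using hH 0 (by omega))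
  have hd1 : colAt p (i + 1) - colAt p i = 1 ∨ colAt p (i + 1) - colAt p i = -1 := by unfold colAt; omega
  refine ⟨hd1, ?_⟩
  set d := colAt p (i + 1) - colAt p i with hd
  -- the statement for two consecutive times, by induction
  have two : ∀ k, k + 1 ≤ m → (colAt p (i + k) = colAt p i + d * k ∧ siteAt p (i + k) 1 = siteAt p i 1) ∧
      (colAt p (i + k + 1) = colAt p i + d * (k + 1) ∧ siteAt p (i + k + 1) 1 = siteAt p i 1) := by
    intro k hk
    induction k with
    | zero =>
      refine ⟨⟨by simp, by simp⟩, ?_, by simpa using h0.1⟩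
      simp only [Nat.cast_zero, zero_add, mul_one, add_zero, hd]; ring
    | succ k ih =>
      obtain ⟨⟨c0, r0⟩, c1, r1⟩ := ih (by omega)
      refine ⟨⟨by simpa [add_assoc] using c1, by simpa [add_assoc] using r1⟩, ?_⟩
      have hs := horiz_step hp (show i + k + 1 < n by omega) (by simpa [add_assoc] using hH (k + 1) (by omega))
      -- no immediate reversal
      have hne : siteAt p (i + k + 1 + 1) ≠ siteAt p (i + k) := by
        intro he
        have := time_eq_of_siteAt_eq hp (by omega) (by omega) he
        omega
      rw [Ne, site_two_eq_iff] at hne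
      rw [show i + (k + 1) + 1 = i + k + 1 + 1 by ring]
      refine ⟨?_, by rw [hs.1, r1]⟩
      unfold colAt at c0 c1 hs ⊢
      push_cast at c1 ⊢
      have r1' := r1; have r0' := r0
      rcases hd1 with h1 | h1 <;> · rw [h1] at c0 c1 ⊢; omega
  intro k hk
  rcases Nat.eq_zero_or_pos k with rfl | hk0
  · simp
  · obtain ⟨k', rfl⟩ := Nat.exists_eq_add_of_le' hk0
    have := (two k' (by omega)).2
    simpa [add_assoc] using this

/-! ### §B.3 The structure lemma: after a second (or later) vertical step, a reversal runs in a dead-end corridor -/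

/-- `gd` after a vertical step followed by horizontal steps is the heading at the time of that vertical step.
[cite: EntingJensen2009, §7.4.2, Fig. 7.10] -/
theorem gd_eq_hd_of_last_vert {t j : ℕ} (ht : vertAt p t = true) (hH : ∀ k < j, vertAt p (t + 1 + k) = false) :
    gd p (t + 1 + j) = hd p t := by
  induction j with
  | zero => simpa using gd_succ_of_vert ht
  | succ j ih =>
    rw [show t + 1 + (j + 1) = t + 1 + j + 1 by ring, gd_succ_of_horiz (hH j (by omega)), ih fun k hk => hH k (by omega)]

/-- After a run of horizontal steps `hd` is the last displacement. [cite: EntingJensen2009, §7.4.2, Fig. 7.10] -/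
theorem hd_eq_of_run {t j : ℕ} (hH : ∀ k < j, vertAt p (t + 1 + k) = false) (hj : 1 ≤ j) :
    hd p (t + 1 + j) = colAt p (t + 1 + j) - colAt p (t + j) := by
  obtain ⟨j', rfl⟩ := Nat.exists_eq_add_of_le' hj
  rw [show t + 1 + (j' + 1) = t + 1 + j' + 1 by ring, hd_succ_of_horiz (hH j' (by omega)), show t + (j' + 1) = t + 1 + j' by ring]

/-- **The corridor is blocked above and below**: if the walk has made at least two vertical steps, its last step is horizontal, and its
heading is opposite to its heading before the last vertical step, then the other site of its current column has already been visited
(so no vertical step is available).  This is the self-avoidance constraint that kills all but two reversals on the two-row ladder.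
[cite: MadrasSlade1993, §1.1 (self-avoidance); BeatonBousquetMelouDeGierDuminilCopinGuttmann2014, §3.1 (arXiv v5 p. 9: walks in the strip of width one)] -/
theorem other_site_visited_of_reversal (hp : p ∈ stripPairs 1 (N + 1)) (hH : vertAt p N = false) (h2 : 2 ≤ nV p (N + 1))
    (hrev : hd p (N + 1) ≠ gd p (N + 1)) :
    ∃ m ≤ N + 1, siteAt p m 0 = colAt p (N + 1) ∧ siteAt p m 1 = 1 - siteAt p (N + 1) 1 := by
  classical
  set S := (Finset.range (N + 1)).filter (fun i => vertAt p i = true) with hS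
  have hcard : S.card = nV p (N + 1) := rfl
  have hSne : S.Nonempty := Finset.card_pos.1 (by omega)
  set t := S.max' hSne with htdef
  have htS : t ∈ S := Finset.max'_mem S hSne
  have htmax : ∀ i ∈ S, i ≤ t := fun i hi => Finset.le_max' S i hi
  obtain ⟨htN, htv⟩ : t < N + 1 ∧ vertAt p t = true := by simpa [hS, Finset.mem_filter] using htS
  have htN' : t ≠ N := by intro he; rw [he, hH] at htv; exact Bool.false_ne_true htv
  set S' := S.erase t with hS'
  have hS'ne : S'.Nonempty := Finset.card_pos.1 (by rw [hS', Finset.card_erase_of_mem htS]; omega)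
  set t' := S'.max' hS'ne with ht'def
  have ht'S' : t' ∈ S' := Finset.max'_mem S' hS'ne
  have ht'max : ∀ i ∈ S', i ≤ t' := fun i hi => Finset.le_max' S' i hi
  obtain ⟨ht't, ht'S⟩ := Finset.mem_erase.1 ht'S'
  obtain ⟨-, ht'v⟩ : t' < N + 1 ∧ vertAt p t' = true := by simpa [hS, Finset.mem_filter] using ht'S
  have ht'lt : t' < t := lt_of_le_of_ne (htmax t' ht'S) ht't
  -- membership tests
  have hnotA : ∀ i, t < i → i < N + 1 → vertAt p i = false := by
    intro i hi hiN
    by_contra hc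
    have hc' : vertAt p i = true := by simpa using hc
    have : i ∈ S := by simp [hS, Finset.mem_filter, hiN, hc']
    exact absurd (htmax i this) (by omega)
  have hnotB : ∀ i, t' < i → i < t → vertAt p i = false := by
    intro i hi hit
    by_contra hc
    have hc' : vertAt p i = true := by simpa using hc
    have hiS : i ∈ S := by simp [hS, Finset.mem_filter, show i < N + 1 by omega, hc']
    have : i ∈ S' := Finset.mem_erase.2 ⟨by omega, hiS⟩
    exact absurd (ht'max i this) (by omega)
  -- no two vertical steps in a row: t ≥ t' + 2
  have ht2 : t' + 2 ≤ t := by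
    by_contra hc
    have he : t = t' + 1 := by omega
    exact not_vert_vert hp (show t' + 1 < N + 1 by omega) ht'v (he ▸ htv)
  -- linearise the times: N = t + 1 + j₀, t = t' + 2 + l₀
  obtain ⟨j₀, hNj⟩ : ∃ j₀, N = t + 1 + j₀ := ⟨N - t - 1, by omega⟩
  obtain ⟨l₀, htl⟩ : ∃ l₀, t = t' + 2 + l₀ := ⟨t - t' - 2, by omega⟩
  -- the two straight runs
  have runA := run_straight hp (i := t + 1) (m := j₀ + 1) (by omega) (by omega) (fun k hk => hnotA (t + 1 + k) (by omega) (by omega))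
  have runB := run_straight hp (i := t' + 1) (m := l₀ + 1) (by omega) (by omega) (fun k hk => hnotB (t' + 1 + k) (by omega) (by omega))
  obtain ⟨hdA, hA⟩ := runA
  obtain ⟨hdB, hB⟩ := runB
  -- the two headings
  have hhd : hd p (N + 1) = colAt p (N + 1) - colAt p N := hd_succ_of_horiz hH
  have hgd : gd p (N + 1) = hd p t := by
    rw [hNj, show t + 1 + j₀ + 1 = t + 1 + (j₀ + 1) by ring]
    exact gd_eq_hd_of_last_vert htv fun k hk => hnotA (t + 1 + k) (by omega) (by omega)
  have hhdt : hd p t = colAt p t - colAt p (t - 1) := by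
    have := hd_eq_of_run (p := p) (t := t') (j := l₀ + 1) (fun k hk => hnotB (t' + 1 + k) (by omega) (by omega)) (by omega)
    rw [show t' + 1 + (l₀ + 1) = t by omega, show t' + (l₀ + 1) = t - 1 by omega] at this
    exact this
  -- geometry of the two vertical steps
  obtain ⟨vt0, vt1, -⟩ := vert_step hp htN htv
  obtain ⟨vt'0, vt'1, -⟩ := vert_step hp (show t' < N + 1 by omega) ht'v
  -- instantiate the runs
  have hA_N := hA (j₀ + 1) le_rfl
  have hA_N1 := hA j₀ (by omega)
  have hB_t := hB (l₀ + 1) le_rfl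
  have hB_t1 := hB l₀ (by omega)
  rw [show t + 1 + (j₀ + 1) = N + 1 by omega] at hA_N
  rw [show t + 1 + j₀ = N by omega] at hA_N1
  rw [show t' + 1 + (l₀ + 1) = t by omega] at hB_t
  rw [show t' + 1 + l₀ = t - 1 by omega] at hB_t1
  -- the current displacement j₀+1 is smaller than the length l₀+1 of the run before the last vertical step
  have hjl : j₀ + 1 ≤ l₀ := by
    by_contra hc
    -- then the time u = t + 1 + (l₀ + 1) ≤ N + 1 revisits the site of time t'
    have hu := hA (l₀ + 1) (by omega)
    have he : siteAt p (t + 1 + (l₀ + 1)) = siteAt p t' := by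
      rw [site_two_eq_iff]
      unfold colAt at *
      push_cast at *
      constructor
      · rcases hdA with h | h <;> rcases hdB with h' | h' <;> rw [h] at hu hA_N hA_N1 <;> rw [h'] at hB_t hB_t1 <;> omega
      · omega
    have := time_eq_of_siteAt_eq hp (by omega) (by omega) he
    omega
  refine ⟨t' + 1 + (l₀ - j₀), by omega, ?_, ?_⟩
  · have hm := hB (l₀ - j₀) (by omega)
    unfold colAt at *
    push_cast at *
    rcases hdA with h | h <;> rcases hdB with h' | h' <;> rw [h] at hA_N hA_N1 <;> rw [h'] at hB_t hB_t1 hm <;> omega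
  · have hm := hB (l₀ - j₀) (by omega)
    omega

/-! ### §B.4 The phase potential and its one-step (fibre) inequality -/

/-- The eight values of the phase potential: initial run (even / odd column), after the first vertical step, forward phase
(odd / even column), after a later vertical step, corridor (odd / even column). [cite: MadrasSlade1993, §1.2 (elementary counting)] -/
structure LVals where
  /-- initial run, even column -/
  runE : ℝ
  /-- initial run, odd column -/
  runO : ℝ
  /-- just after the first vertical step -/
  rg1 : ℝ
  /-- forward phase, odd column -/
  fA : ℝ
  /-- forward phase, even column -/
  fB : ℝ
  /-- just after a later vertical step -/
  rg2 : ℝ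
  /-- corridor, odd column -/
  coO : ℝ
  /-- corridor, even column -/
  coE : ℝ

/-- The phase potential as a function of (number of vertical steps so far, last step vertical?, forward flag, even column?).
[cite: MadrasSlade1993, §1.2 (elementary counting)] -/
def phase (P : LVals) (k : ℕ) (v fw ev : Bool) : ℝ :=
  if k = 0 then (if ev = true then P.runE else P.runO)
  else if v = true then (if k = 1 then P.rg1 else P.rg2)
  else if fw = true then (if ev = true then P.fB else P.fA)
  else (if ev = true then P.coE else P.coO)

/-- The forward flag: first vertical step only, or heading unchanged across the last vertical step. [cite: EntingJensen2009, §7.4.2, Fig. 7.10] -/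
def fwF (p : Site 2 × (ℕ → Site 2)) (n : ℕ) : Bool := decide (nV p n = 1 ∨ hd p n = gd p n)

/-- The even-column flag. [cite: EntingJensen2009, §7.4.2, Fig. 7.10] -/
def evF (p : Site 2 × (ℕ → Site 2)) (n : ℕ) : Bool := decide (colAt p n % 2 = 0)

/-- The potential of a walk after `N + 1` steps. [cite: MadrasSlade1993, §1.2 (elementary counting)] -/
def phiAt (P : LVals) (p : Site 2 × (ℕ → Site 2)) (N : ℕ) : ℝ := phase P (nV p (N + 1)) (vertAt p N) (fwF p (N + 1)) (evF p (N + 1))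

/-- **Sub-harmonicity of the phase potential at rate `ρ`** for the wall weight `y` on the two-row ladder.
[cite: MadrasSlade1993, §1.2 (elementary counting)] -/
structure LValid (y ρ : ℝ) (P : LVals) : Prop where
  pos_y : 0 < y
  pos_ρ : 0 < ρ
  pos_runE : 0 < P.runE
  pos_runO : 0 < P.runO
  pos_rg1 : 0 < P.rg1
  pos_fA : 0 < P.fA
  pos_fB : 0 < P.fB
  pos_rg2 : 0 < P.rg2
  pos_coO : 0 < P.coO
  pos_coE : 0 < P.coE
  run_o : P.runE ≤ ρ * P.runO
  run_e : y * P.runO + P.rg1 ≤ ρ * P.runE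
  rg1_le : y * P.fA + y * P.fA ≤ ρ * P.rg1
  fwd_o : P.fB ≤ ρ * P.fA
  fwd_e : y * P.fA + P.rg2 ≤ ρ * P.fB
  rg2_le : y * P.fA + y * P.coO ≤ ρ * P.rg2
  co_o : P.coE ≤ ρ * P.coO
  co_e : y * P.coO ≤ ρ * P.coE

variable {P : LVals}

/-- The least potential value. [cite: MadrasSlade1993, §1.2 (elementary counting)] -/
def pmin (P : LVals) : ℝ := min P.runE (min P.runO (min P.rg1 (min P.fA (min P.fB (min P.rg2 (min P.coO P.coE))))))

/-- `0 < pmin`. [cite: MadrasSlade1993, §1.2 (elementary counting)] -/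
theorem pmin_pos (hV : LValid y ρ P) : 0 < pmin P := by
  unfold pmin
  have := hV.pos_runE; have := hV.pos_runO; have := hV.pos_rg1; have := hV.pos_fA; have := hV.pos_fB; have := hV.pos_rg2
  have := hV.pos_coO; have := hV.pos_coE
  positivity

/-- `pmin ≤ phase`. [cite: MadrasSlade1993, §1.2 (elementary counting)] -/
theorem pmin_le_phase (P : LVals) (k : ℕ) (v fw ev : Bool) : pmin P ≤ phase P k v fw ev := by
  unfold pmin phase
  have h1 := min_le_left P.runE (min P.runO (min P.rg1 (min P.fA (min P.fB (min P.rg2 (min P.coO P.coE))))))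
  have h2 := min_le_right P.runE (min P.runO (min P.rg1 (min P.fA (min P.fB (min P.rg2 (min P.coO P.coE))))))
  have h3 := min_le_left P.runO (min P.rg1 (min P.fA (min P.fB (min P.rg2 (min P.coO P.coE)))))
  have h4 := min_le_right P.runO (min P.rg1 (min P.fA (min P.fB (min P.rg2 (min P.coO P.coE)))))
  have h5 := min_le_left P.rg1 (min P.fA (min P.fB (min P.rg2 (min P.coO P.coE))))
  have h6 := min_le_right P.rg1 (min P.fA (min P.fB (min P.rg2 (min P.coO P.coE))))
  have h7 := min_le_left P.fA (min P.fB (min P.rg2 (min P.coO P.coE)))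
  have h8 := min_le_right P.fA (min P.fB (min P.rg2 (min P.coO P.coE)))
  have h9 := min_le_left P.fB (min P.rg2 (min P.coO P.coE))
  have h10 := min_le_right P.fB (min P.rg2 (min P.coO P.coE))
  have h11 := min_le_left P.rg2 (min P.coO P.coE)
  have h12 := min_le_right P.rg2 (min P.coO P.coE)
  have h13 := min_le_left P.coO P.coE
  have h14 := min_le_right P.coO P.coE
  split_ifs <;> linarith

/-- `0 < phase`. [cite: MadrasSlade1993, §1.2 (elementary counting)] -/
theorem phase_pos (hV : LValid y ρ P) (k : ℕ) (v fw ev : Bool) : 0 < phase P k v fw ev :=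
  (pmin_pos hV).trans_le (pmin_le_phase P k v fw ev)

/-- The phase potential in the initial run. [cite: MadrasSlade1993, §1.2 (elementary counting)] -/
theorem phase_run (P : LVals) {k : ℕ} (hk : k = 0) (v fw ev : Bool) : phase P k v fw ev = if ev = true then P.runE else P.runO := by
  simp [phase, hk]
/-- The phase potential just after a vertical step. [cite: MadrasSlade1993, §1.2 (elementary counting)] -/
theorem phase_vert (P : LVals) {k : ℕ} (hk : k ≠ 0) (fw ev : Bool) : phase P k true fw ev = if k = 1 then P.rg1 else P.rg2 := by
  simp [phase, hk]
/-- The phase potential in the forward phase. [cite: MadrasSlade1993, §1.2 (elementary counting)] -/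
theorem phase_fwd (P : LVals) {k : ℕ} (hk : k ≠ 0) (ev : Bool) : phase P k false true ev = if ev = true then P.fB else P.fA := by
  simp [phase, hk]
/-- The phase potential in a corridor. [cite: MadrasSlade1993, §1.2 (elementary counting)] -/
theorem phase_co (P : LVals) {k : ℕ} (hk : k ≠ 0) (ev : Bool) : phase P k false false ev = if ev = true then P.coE else P.coO := by
  simp [phase, hk]

/-- On `S_1` the wall weight of a site is `y` at odd columns and `1` at even columns (both rows).
[cite: BeatonBousquetMelouDeGierDuminilCopinGuttmann2014, §3.2 (arXiv v5 p. 10: bc(ω), tc(ω))] -/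
theorem wArr_one_eq {n : ℕ} (hp : p ∈ stripPairs 1 n) (y : ℝ) {m : ℕ} (hm : m ≤ n) :
    wArr 1 y (rowAt p m) (parAt p m) = if colAt p m % 2 = 0 then 1 else y := by
  have r01 := row01 hp hm
  unfold wArr rowAt parAt colAt
  push_cast
  split_ifs <;> first | rfl | omega

/-- The direction encoded by a horizontal code. [cite: EntingJensen2009, §7.4.2, Fig. 7.10] -/
def dirOf (c : ℕ) : ℤ := if c = 0 then 1 else -1

/-- Code `0` is the direction `+1`. [cite: EntingJensen2009, §7.4.2, Fig. 7.10] -/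
@[simp] theorem dirOf_zero : dirOf 0 = 1 := by simp [dirOf]
/-- Code `1` is the direction `−1`. [cite: EntingJensen2009, §7.4.2, Fig. 7.10] -/
@[simp] theorem dirOf_one : dirOf 1 = -1 := by simp [dirOf]

/-- The value (new weight × new potential) attached to a code, seen from the data of the prefix. [cite: MadrasSlade1993, §1.2 (elementary counting)] -/
def cv (y : ℝ) (P : LVals) (x G : ℤ) (k : ℕ) (c : ℕ) : ℝ :=
  if c = 2 then (if k = 0 then P.rg1 else P.rg2)
  else (if (x + dirOf c) % 2 = 0 then 1 else y) * phase P k false (decide (k = 1 ∨ dirOf c = G)) (decide ((x + dirOf c) % 2 = 0))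

/-- `0 ≤ cv`. [cite: MadrasSlade1993, §1.2 (elementary counting)] -/
theorem cv_nonneg (hV : LValid y ρ P) (x G : ℤ) (k c : ℕ) : 0 ≤ cv y P x G k c := by
  unfold cv
  split_ifs
  · exact hV.pos_rg1.le
  · exact hV.pos_rg2.le
  · exact mul_nonneg zero_le_one (phase_pos hV _ _ _ _).le
  · exact mul_nonneg hV.pos_y.le (phase_pos hV _ _ _ _).le

open Classical in
/-- **The fibre inequality on the ladder**: over the walks of length `N+2` with a given prefix of length `N+1`, the new weight times the
new phase potential sums to at most `ρ` times the potential of the prefix.  The self-avoidance input beyond non-backtracking is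
`other_site_visited_of_reversal` (no vertical step out of a corridor). [cite: MadrasSlade1993, §1.2 (elementary counting); EntingJensen2009, §7.4.2, Fig. 7.10] -/
theorem sum_fibre_le (hV : LValid y ρ P) (hp' : p' ∈ stripPairs 1 (N + 1)) :
    ∑ p ∈ (stripPairs 1 (N + 1 + 1)).filter (fun p => pref (N + 1) p = p'),
        wArr 1 y (rowAt p (N + 1 + 1)) (parAt p (N + 1 + 1)) * phiAt P p (N + 1) ≤ ρ * phiAt P p' N := by
  set F := (stripPairs 1 (N + 1 + 1)).filter (fun p => pref (N + 1) p = p') with hF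
  set k := nV p' (N + 1) with hk
  set x := colAt p' (N + 1) with hx
  set G := gd p' (N + 1) with hG
  have hy := hV.pos_y
  -- anatomy of a member of the fibre
  have anat : ∀ p ∈ F, p ∈ stripPairs 1 (N + 1 + 1) ∧ pref (N + 1) p = p' ∧ (∀ i ≤ N + 1, siteAt p i = siteAt p' i) ∧
      vertAt p N = vertAt p' N ∧ nV p (N + 1) = k ∧ hd p (N + 1) = hd p' (N + 1) ∧ gd p (N + 1) = G ∧ colAt p (N + 1) = x := by
    intro p hp
    obtain ⟨hpS, hpre⟩ := Finset.mem_filter.1 hp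
    have hs : ∀ i ≤ N + 1, siteAt p i = siteAt p' i := fun i hi => siteAt_eq_of_pref_eq hpre hi
    obtain ⟨hv, hn, hh, hg, hc⟩ := obs_congr hs
    exact ⟨hpS, hpre, hs, hv N (Nat.lt_succ_self N), hn, hh, hg, hc⟩
  -- (i) the summand is the code value
  have hval : ∀ p ∈ F, wArr 1 y (rowAt p (N + 1 + 1)) (parAt p (N + 1 + 1)) * phiAt P p (N + 1) = cv y P x G k (lastCode N p) := by
    intro p hp
    obtain ⟨hpS, -, hs, hvN, hn, hh, hg, hc⟩ := anat p hp
    rw [wArr_one_eq hpS y le_rfl]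
    have hn2 : nV p (N + 1 + 1) = k + (if vertAt p (N + 1) = true then 1 else 0) := by rw [nV_succ, hn]
    cases hvv : vertAt p (N + 1)
    · -- horizontal last step
      obtain ⟨hrow, hcol⟩ := horiz_step hpS (Nat.lt_succ_self _) hvv
      have hc01 : (lastCode N p = 0 ∧ colAt p (N + 1 + 1) = x + 1) ∨ (lastCode N p = 1 ∧ colAt p (N + 1 + 1) = x - 1) := by
        unfold colAt at hc ⊢
        rcases hcol with h | h
        · left; refine ⟨by unfold lastCode; rw [hvv]; simp [h], by rw [h, hc]⟩
        · right; refine ⟨by unfold lastCode; rw [hvv]; simp [show ¬(siteAt p (N + 1 + 1) 0 = siteAt p (N + 1) 0 + 1) by omega], by rw [h, hc]⟩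
      have hcode : lastCode N p ≠ 2 := by rcases hc01 with ⟨h, -⟩ | ⟨h, -⟩ <;> rw [h] <;> norm_num
      have hdir : colAt p (N + 1 + 1) = x + dirOf (lastCode N p) := by
        rcases hc01 with ⟨h, h'⟩ | ⟨h, h'⟩ <;> rw [h, h'] <;> simp [sub_eq_add_neg]
      have hhd2 : hd p (N + 1 + 1) = dirOf (lastCode N p) := by rw [hd_succ_of_horiz hvv, hdir, hc]; ring
      have hgd2 : gd p (N + 1 + 1) = G := by rw [gd_succ_of_horiz hvv, hg]
      rw [hvv] at hn2; simp only [Bool.false_eq_true, if_false, add_zero] at hn2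
      unfold phiAt fwF evF
      rw [hn2, hvv, hhd2, hgd2, hdir, cv, if_neg hcode]
    · -- vertical last step
      obtain ⟨vc, vr, veven⟩ := vert_step hpS (Nat.lt_succ_self _) hvv
      have hcode : lastCode N p = 2 := by unfold lastCode; rw [hvv]; simp
      have hcol2 : colAt p (N + 1 + 1) % 2 = 0 := by unfold colAt; rw [vc]; exact veven
      rw [hvv] at hn2; simp only [if_true] at hn2
      unfold phiAt
      rw [hn2, hvv, hcode, cv, if_pos rfl, if_pos hcol2, one_mul, phase_vert P (Nat.succ_ne_zero k)]
      simp
  -- (ii) the code is injective on the fibre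
  have hinj : Set.InjOn (lastCode N) ↑F := by
    intro p₁ h₁ p₂ h₂ hcd
    rw [Finset.mem_coe] at h₁ h₂
    obtain ⟨hS₁, hpre₁, hs₁, -⟩ := anat p₁ h₁
    obtain ⟨hS₂, hpre₂, hs₂, -⟩ := anat p₂ h₂
    refine eq_of_pref_eq_of_siteAt_eq hS₁ hS₂ (hpre₁.trans hpre₂.symm) ?_
    have e₁ := last_step_coord (N := N + 1) hS₁
    have e₂ := last_step_coord (N := N + 1) hS₂
    have hx₁ := hs₁ (N + 1) le_rfl
    have hx₂ := hs₂ (N + 1) le_rfl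
    rw [site_two_eq_iff] at hx₁ hx₂
    have r₁ := row01 hS₁ (le_refl (N + 1 + 1)); have r₁' := row01 hS₁ (Nat.le_succ (N + 1))
    have r₂ := row01 hS₂ (le_refl (N + 1 + 1)); have r₂' := row01 hS₂ (Nat.le_succ (N + 1))
    unfold lastCode vertAt at hcd
    simp only [decide_eq_true_eq] at hcd
    rw [site_two_eq_iff]
    split_ifs at hcd <;> omega
  -- (iii) rewrite the sum over codes
  have hsum : ∑ p ∈ F, wArr 1 y (rowAt p (N + 1 + 1)) (parAt p (N + 1 + 1)) * phiAt P p (N + 1) =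
      ∑ c ∈ F.image (lastCode N), cv y P x G k c := by
    rw [Finset.sum_image hinj]; exact Finset.sum_congr rfl hval
  rw [hsum]
  have bound : ∀ s : Finset ℕ, F.image (lastCode N) ⊆ s → ∑ c ∈ F.image (lastCode N), cv y P x G k c ≤ ∑ c ∈ s, cv y P x G k c :=
    fun s hs => Finset.sum_le_sum_of_subset_of_nonneg hs fun c _ _ => cv_nonneg hV x G k c
  -- facts about members of the image
  have img : ∀ c ∈ F.image (lastCode N), ∃ p ∈ F, lastCode N p = c := fun c hc => by simpa [Finset.mem_image] using hc
  have hkN : phiAt P p' N = phase P k (vertAt p' N) (fwF p' (N + 1)) (evF p' (N + 1)) := rfl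
  cases hvN : vertAt p' N
  · ---------------- last step of the prefix horizontal ----------------
    obtain ⟨hrow, hcol⟩ := horiz_step hp' (Nat.lt_succ_self N) hvN
    have hhd : hd p' (N + 1) = colAt p' (N + 1) - colAt p' N := hd_succ_of_horiz hvN
    have hd1' : hd p' (N + 1) = 1 ∨ hd p' (N + 1) = -1 := by rw [hhd]; unfold colAt; omega
    -- the forward code `c₀` and its direction `d = hd p' (N+1)`
    obtain ⟨d, hdd⟩ : ∃ d, hd p' (N + 1) = d := ⟨_, rfl⟩
    have hd1 : d = 1 ∨ d = -1 := hdd ▸ hd1'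
    have hxd : colAt p' (N + 1) = colAt p' N + d := by rw [← hdd, hhd]; ring
    obtain ⟨c₀, hc₀, hc₀2, hdir₀⟩ : ∃ c₀ : ℕ, ((d = 1 ∧ c₀ = 0) ∨ (d = -1 ∧ c₀ = 1)) ∧ c₀ ≠ 2 ∧ dirOf c₀ = d := by
      rcases hd1 with h | h
      · exact ⟨0, Or.inl ⟨h, rfl⟩, by norm_num, by rw [h]; exact dirOf_zero⟩
      · exact ⟨1, Or.inr ⟨h, rfl⟩, by norm_num, by rw [h]; exact dirOf_one⟩
    -- codes: the forward code, and possibly the vertical one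
    have hsub : F.image (lastCode N) ⊆ ({c₀, 2} : Finset ℕ) := by
      intro c hc
      obtain ⟨p, hp, rfl⟩ := img c hc
      obtain ⟨hpS, -, hs, -⟩ := anat p hp
      have e := last_step_coord (N := N + 1) hpS
      have hne := siteAt_add_two_ne hpS
      rw [Ne, site_two_eq_iff] at hne
      have hx₁ := hs (N + 1) le_rfl; have hx₀ := hs N (Nat.le_succ N)
      rw [site_two_eq_iff] at hx₁ hx₀
      rw [Finset.mem_insert, Finset.mem_singleton]
      unfold colAt at hxd
      unfold lastCode vertAt
      simp only [decide_eq_true_eq]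
      rcases hc₀ with ⟨hdv, rfl⟩ | ⟨hdv, rfl⟩ <;> rw [hdv] at hxd <;> split_ifs <;> omega
    -- no vertical code at an odd column, nor out of a corridor
    have hsub' : x % 2 ≠ 0 ∨ (k ≠ 0 ∧ fwF p' (N + 1) = false) → F.image (lastCode N) ⊆ ({c₀} : Finset ℕ) := by
      intro hcase c hc
      have hc2 := hsub hc
      rw [Finset.mem_insert, Finset.mem_singleton] at hc2
      rw [Finset.mem_singleton]
      rcases hc2 with hc2 | hc2
      · exact hc2
      exfalso
      obtain ⟨p, hp, hpc⟩ := img c hc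
      obtain ⟨hpS, -, hs, -, hn, hh, hg, hcx⟩ := anat p hp
      have hvv : vertAt p (N + 1) = true := by
        by_contra hv'
        have hv'' : vertAt p (N + 1) = false := by simpa using hv'
        have : lastCode N p ≠ 2 := by unfold lastCode; rw [hv'']; simp only [Bool.false_eq_true, if_false]; split_ifs <;> omega
        exact this (hpc.trans hc2)
      obtain ⟨vc, vr, veven⟩ := vert_step hpS (Nat.lt_succ_self _) hvv
      rcases hcase with hodd | ⟨hk0, hfw⟩
      · apply hodd; rw [← hcx]; unfold colAt; exact veven
      · -- corridor: the target of the vertical step was visited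
        have hk1 : ¬(k = 1 ∨ hd p' (N + 1) = G) := by
          intro h; unfold fwF at hfw; rw [← hk, ← hG] at hfw; simp only [decide_eq_false_iff_not] at hfw; exact hfw h
        have hk1a : k ≠ 1 := fun h => hk1 (Or.inl h)
        have hk1b : hd p' (N + 1) ≠ G := fun h => hk1 (Or.inr h)
        have h2 : 2 ≤ nV p' (N + 1) := by rw [← hk]; omega
        obtain ⟨m, hm, hm0, hm1⟩ := other_site_visited_of_reversal hp' hvN h2 (by rw [← hG]; exact hk1b)
        have he : siteAt p (N + 1 + 1) = siteAt p m := by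
          rw [hs m hm, site_two_eq_iff]
          have := hs (N + 1) le_rfl
          rw [site_two_eq_iff] at this
          unfold colAt at hm0
          constructor <;> omega
        have := time_eq_of_siteAt_eq hpS le_rfl (by omega) he
        omega
    -- evaluate
    have hev' : ((x + d) % 2 = 0) ↔ ¬(x % 2 = 0) := by rcases hd1 with h | h <;> rw [h] <;> omega
    by_cases hk0 : k = 0
    · -- initial run
      rw [hkN, phase_run P hk0]
      by_cases hxe : x % 2 = 0
      · refine (bound _ hsub).trans ?_
        rw [Finset.sum_pair hc₀2]
        have hxo : ¬((x + d) % 2 = 0) := by rw [hev']; exact not_not.2 hxe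
        simp only [cv, hc₀2, if_false, if_true, hdir₀, hxo, hk0, phase, decide_false]
        unfold evF; rw [← hx]; simp only [hxe, decide_true, if_true]
        simp
        linarith [hV.run_e]
      · refine (bound _ (hsub' (Or.inl hxe))).trans ?_
        rw [Finset.sum_singleton]
        have hxo : (x + d) % 2 = 0 := by rw [hev']; exact hxe
        simp only [cv, hc₀2, if_false, if_true, hdir₀, hxo, hk0, phase]
        unfold evF; rw [← hx]; simp only [hxe, decide_false]
        simp
        linarith [hV.run_o]
    · cases hfw : fwF p' (N + 1)
      · -- corridor
        have hfw' : decide (k = 1 ∨ d = G) = false := by unfold fwF at hfw; rw [← hk, hdd, ← hG] at hfw; exact hfw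
        rw [hkN, hvN, hfw, phase_co P hk0]
        refine (bound _ (hsub' (Or.inr ⟨hk0, hfw⟩))).trans ?_
        rw [Finset.sum_singleton]
        by_cases hxe : x % 2 = 0
        · have hxo : ¬((x + d) % 2 = 0) := by rw [hev']; exact not_not.2 hxe
          simp only [cv, hc₀2, if_false, hdir₀, hxo, hfw', phase_co P hk0, decide_false]
          unfold evF; rw [← hx]; simp only [hxe, decide_true, if_true]
          simp
          linarith [hV.co_e]
        · have hxo : (x + d) % 2 = 0 := by rw [hev']; exact hxe
          simp only [cv, hc₀2, if_false, if_true, hdir₀, hxo, hfw', phase_co P hk0, decide_true]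
          unfold evF; rw [← hx]; simp only [hxe, decide_false]
          simp
          linarith [hV.co_o]
      · -- forward
        have hfw' : decide (k = 1 ∨ d = G) = true := by unfold fwF at hfw; rw [← hk, hdd, ← hG] at hfw; exact hfw
        rw [hkN, hvN, hfw, phase_fwd P hk0]
        by_cases hxe : x % 2 = 0
        · refine (bound _ hsub).trans ?_
          rw [Finset.sum_pair hc₀2]
          have hxo : ¬((x + d) % 2 = 0) := by rw [hev']; exact not_not.2 hxe
          simp only [cv, hc₀2, if_false, if_true, hdir₀, hxo, hfw', phase_fwd P hk0, hk0, decide_false]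
          unfold evF; rw [← hx]; simp only [hxe, decide_true, if_true]
          simp
          linarith [hV.fwd_e]
        · -- at an odd column the vertical code does not occur
          refine (bound _ (hsub' (Or.inl hxe))).trans ?_
          rw [Finset.sum_singleton]
          have hxo : (x + d) % 2 = 0 := by rw [hev']; exact hxe
          simp only [cv, hc₀2, if_false, if_true, hdir₀, hxo, hfw', phase_fwd P hk0, decide_true]
          unfold evF; rw [← hx]; simp only [hxe, decide_false]
          simp
          linarith [hV.fwd_o]
  · ---------------- last step of the prefix vertical ----------------
    obtain ⟨vc, vr, veven⟩ := vert_step hp' (Nat.lt_succ_self N) hvN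
    have hxe : x % 2 = 0 := by rw [hx]; unfold colAt; rw [vc]; exact veven
    have hk1 : 1 ≤ k := by rw [hk, nV_succ, hvN]; simp
    have hk0 : k ≠ 0 := by omega
    -- codes ⊆ {0, 1}
    have hsub : F.image (lastCode N) ⊆ ({0, 1} : Finset ℕ) := by
      intro c hc
      obtain ⟨p, hp, rfl⟩ := img c hc
      obtain ⟨hpS, -, hs, -⟩ := anat p hp
      have e := last_step_coord (N := N + 1) hpS
      have hne := siteAt_add_two_ne hpS
      rw [Ne, site_two_eq_iff] at hne
      have hx₁ := hs (N + 1) le_rfl; have hx₀ := hs N (Nat.le_succ N)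
      rw [site_two_eq_iff] at hx₁ hx₀
      have r2 := row01 hpS (le_refl (N + 1 + 1))
      have r1 := row01 hp' (le_refl (N + 1)); have r0 := row01 hp' (Nat.le_succ N)
      rw [Finset.mem_insert, Finset.mem_singleton]
      unfold lastCode vertAt
      simp only [decide_eq_true_eq]
      split_ifs <;> omega
    refine (bound _ hsub).trans ?_
    rw [Finset.sum_pair (by norm_num), hkN, hvN, phase_vert P hk0]
    have hx1 : ¬((x + 1) % 2 = 0) := by omega
    have hx2 : ¬((x + -1) % 2 = 0) := by omega
    by_cases hk1' : k = 1
    · simp only [cv, show (0:ℕ) ≠ 2 by norm_num, show (1:ℕ) ≠ 2 by norm_num, if_false, dirOf, if_true, one_ne_zero, hx1, hx2, hk1',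
        true_or, decide_true, phase_fwd P one_ne_zero, decide_false]
      simp
      linarith [hV.rg1_le]
    · -- the heading before this vertical step is `±1`; exactly one of the two horizontal codes continues it
      have hG1 : G = 1 ∨ G = -1 := by
        -- `N ≥ 1`, the step `N-1` is horizontal
        have hN : N ≠ 0 := by
          rintro rfl
          have : k = 1 := by rw [hk, nV_succ, hvN]; simp [nV]
          exact hk1' this
        obtain ⟨M, rfl⟩ := Nat.exists_eq_succ_of_ne_zero hN
        have hvM : vertAt p' M = false := by
          by_contra hc
          have hc' : vertAt p' M = true := by simpa using hc
          exact not_vert_vert hp' (by omega) hc' hvN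
        have := horiz_step hp' (show M < M + 1 + 1 by omega) hvM
        rw [hG, gd_succ_of_vert hvN, hd_succ_of_horiz hvM]
        unfold colAt; omega
      simp only [cv, show (0:ℕ) ≠ 2 by norm_num, show (1:ℕ) ≠ 2 by norm_num, if_false, dirOf, if_true, one_ne_zero, hx1, hx2, hk1',
        false_or, decide_false, if_false]
      rcases hG1 with h | h
      · rw [h]; simp only [decide_true, show ((-1:ℤ) = 1) = False by norm_num, decide_false, phase_fwd P hk0, phase_co P hk0]
        simp
        linarith [hV.rg2_le]
      · rw [h]; simp only [decide_true, show ((1:ℤ) = -1) = False by norm_num, decide_false, phase_fwd P hk0, phase_co P hk0]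
        simp
        linarith [hV.rg2_le]

/-! ### §B.5 The potential-weighted partition function is sub-geometric; `μ_1(y,y) ≤ ρ` -/

/-- `Σ_ω y^{bc+tc} · (phase potential after the last step)` over the walks of `S_1` of length `N + 1`.
[cite: BeatonBousquetMelouDeGierDuminilCopinGuttmann2014, §3.2 (arXiv v5 p. 10: C_{T,k}(y,z)); MadrasSlade1993, §1.2 (elementary counting)] -/
def potSum (y : ℝ) (P : LVals) (N : ℕ) : ℝ :=
  ∑ p ∈ stripPairs 1 (N + 1), y ^ (bottomVisits₀ p.1 p.2 (N + 1) + topVisits₀ 1 p.1 p.2 (N + 1)) * phiAt P p N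

/-- `0 ≤ potSum`. [cite: MadrasSlade1993, §1.2 (elementary counting)] -/
theorem potSum_nonneg (hV : LValid y ρ P) (N : ℕ) : 0 ≤ potSum y P N :=
  Finset.sum_nonneg fun _ _ => mul_nonneg (pow_nonneg hV.pos_y.le _) (phase_pos hV _ _ _ _).le

open Classical in
/-- **One step costs at most a factor `ρ`**: `potSum (N+1) ≤ ρ · potSum N`. [cite: MadrasSlade1993, §1.2 (elementary counting)] -/
theorem potSum_succ_le (hV : LValid y ρ P) (N : ℕ) : potSum y P (N + 1) ≤ ρ * potSum y P N := by
  unfold potSum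
  have hmaps : ∀ p ∈ stripPairs 1 (N + 1 + 1), pref (N + 1) p ∈ stripPairs 1 (N + 1) := fun p hp => pref_mem hp
  rw [← Finset.sum_fiberwise_of_maps_to hmaps, Finset.mul_sum]
  refine Finset.sum_le_sum fun p' hp' => ?_
  have hfib : ∀ p ∈ (stripPairs 1 (N + 1 + 1)).filter (fun p => pref (N + 1) p = p'),
      y ^ (bottomVisits₀ p.1 p.2 (N + 1 + 1) + topVisits₀ 1 p.1 p.2 (N + 1 + 1)) * phiAt P p (N + 1) =
        y ^ (bottomVisits₀ p'.1 p'.2 (N + 1) + topVisits₀ 1 p'.1 p'.2 (N + 1)) *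
          (wArr 1 y (rowAt p (N + 1 + 1)) (parAt p (N + 1 + 1)) * phiAt P p (N + 1)) := by
    intro p hp
    obtain ⟨-, hpre⟩ := Finset.mem_filter.1 hp
    rw [pow_visits_succ le_rfl, ← hpre, visits_pref, mul_assoc]
  rw [Finset.sum_congr rfl hfib, ← Finset.mul_sum]
  have hy0 : 0 ≤ y ^ (bottomVisits₀ p'.1 p'.2 (N + 1) + topVisits₀ 1 p'.1 p'.2 (N + 1)) := pow_nonneg hV.pos_y.le _
  calc y ^ (bottomVisits₀ p'.1 p'.2 (N + 1) + topVisits₀ 1 p'.1 p'.2 (N + 1)) *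
        ∑ p ∈ (stripPairs 1 (N + 1 + 1)).filter (fun p => pref (N + 1) p = p'),
          wArr 1 y (rowAt p (N + 1 + 1)) (parAt p (N + 1 + 1)) * phiAt P p (N + 1)
      ≤ y ^ (bottomVisits₀ p'.1 p'.2 (N + 1) + topVisits₀ 1 p'.1 p'.2 (N + 1)) * (ρ * phiAt P p' N) :=
        mul_le_mul_of_nonneg_left (sum_fibre_le hV hp') hy0
    _ = ρ * (y ^ (bottomVisits₀ p'.1 p'.2 (N + 1) + topVisits₀ 1 p'.1 p'.2 (N + 1)) * phiAt P p' N) := by ring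

/-- `potSum N ≤ ρ^N · potSum 0`. [cite: MadrasSlade1993, §1.2 (elementary counting)] -/
theorem potSum_le_pow_mul (hV : LValid y ρ P) (N : ℕ) : potSum y P N ≤ ρ ^ N * potSum y P 0 := by
  induction N with
  | zero => simp
  | succ N ih =>
    calc potSum y P (N + 1) ≤ ρ * potSum y P N := potSum_succ_le hV N
      _ ≤ ρ * (ρ ^ N * potSum y P 0) := mul_le_mul_of_nonneg_left ih hV.pos_ρ.le
      _ = ρ ^ (N + 1) * potSum y P 0 := by ring

/-- `C_{1,N+1}(y,y) ≤ potSum N / pmin`. [cite: BeatonBousquetMelouDeGierDuminilCopinGuttmann2014, §3.2 (arXiv v5 p. 10: C_{T,k}(y,z))] -/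
theorem stripZ₂_le_potSum_div (hV : LValid y ρ P) (N : ℕ) : stripZ₂ 1 (N + 1) y y ≤ potSum y P N / pmin P := by
  have hm := pmin_pos hV
  rw [le_div_iff₀ hm, stripZ₂, potSum, Finset.sum_mul]
  refine Finset.sum_le_sum fun p _ => ?_
  rw [← pow_add]
  exact mul_le_mul_of_nonneg_left (pmin_le_phase P _ _ _ _) (pow_nonneg hV.pos_y.le _)

/-- **`μ_1(y,y) ≤ ρ`** whenever the phase potential is sub-harmonic at rate `ρ`.
[cite: BeatonBousquetMelouDeGierDuminilCopinGuttmann2014, §3.2 Proposition 6 (arXiv v5 p. 10: μ_T(y,z) = lim C_{T,k}(y,z)^{1/k}); MadrasSlade1993, §8.2 (8.2.2)–(8.2.3)] -/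
theorem stripMuY₂_one_self_le_of_valid (hV : LValid y ρ P) : stripMuY₂ 1 y y ≤ ρ := by
  have hy0 := hV.pos_y
  have hρ := hV.pos_ρ
  have hm := pmin_pos hV
  set C : ℝ := potSum y P 0 / (pmin P * ρ) + 1 with hC
  have hC0 : 0 < C := by
    rw [hC]; have := div_nonneg (potSum_nonneg hV 0) (mul_pos hm hρ).le; linarith
  have hb : ∀ N, stripZ₂ 1 (N + 1) y y ≤ C * ρ ^ (N + 1) := by
    intro N
    calc stripZ₂ 1 (N + 1) y y ≤ potSum y P N / pmin P := stripZ₂_le_potSum_div hV N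
      _ ≤ ρ ^ N * potSum y P 0 / pmin P := div_le_div_of_nonneg_right (potSum_le_pow_mul hV N) hm.le
      _ = potSum y P 0 / (pmin P * ρ) * ρ ^ (N + 1) := by field_simp; ring
      _ ≤ C * ρ ^ (N + 1) := by rw [hC]; nlinarith [pow_pos hρ (N + 1)]
  have hL := tendsto_stripZ₂_rpow 1 hy0 hy0
  have hR : Tendsto (fun n : ℕ => C ^ (1 / (n : ℝ)) * ρ) atTop (𝓝 (1 * ρ)) :=
    (tendsto_const_rpow_one_div_nat₀ hC0).mul_const ρ
  rw [one_mul] at hR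
  refine le_of_tendsto_of_tendsto hL hR (Filter.eventually_atTop.2 ⟨1, fun n hn => ?_⟩)
  obtain ⟨N, rfl⟩ := Nat.exists_eq_add_of_le' hn
  have hZ0 : 0 ≤ stripZ₂ 1 (N + 1) y y := (stripZ₂_pos 1 _ hy0 hy0).le
  have e : C ^ (1 / ((N + 1 : ℕ) : ℝ)) * ρ = (C * ρ ^ (N + 1)) ^ (1 / ((N + 1 : ℕ) : ℝ)) := by
    rw [Real.mul_rpow hC0.le (pow_nonneg hρ.le _), one_div, Real.pow_rpow_inv_natCast hρ.le (Nat.succ_ne_zero N)]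
  show stripZ₂ 1 (N + 1) y y ^ (1 / ((N + 1 : ℕ) : ℝ)) ≤ C ^ (1 / ((N + 1 : ℕ) : ℝ)) * ρ
  rw [e]
  exact Real.rpow_le_rpow hZ0 (hb N) (by positivity)

/-! ### §B.6 The explicit potential at every rate `ρ` with `ρ³ > yρ + y`, and the exact value of `μ_1(y,y)` -/

/-- The explicit phase potential at rate `ρ` (`ρ³ > yρ + y`): forward `(1, ρ)`, later vertical step `ρ² − y`, corridor
`((ρ³−yρ−y)/y, (ρ³−yρ−y)/ρ)`, first vertical step `2y/ρ`, initial run `(2y/(ρ²−y), 2y/(ρ(ρ²−y)))`.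
[cite: MadrasSlade1993, §1.2 (elementary counting)] -/
def lvals (y ρ : ℝ) : LVals where
  runE := 2 * y / (ρ ^ 2 - y)
  runO := 2 * y / (ρ * (ρ ^ 2 - y))
  rg1 := 2 * y / ρ
  fA := 1
  fB := ρ
  rg2 := ρ ^ 2 - y
  coO := (ρ ^ 3 - y * ρ - y) / y
  coE := (ρ ^ 3 - y * ρ - y) / ρ

/-- **The explicit potential is sub-harmonic at every rate `ρ > 0` with `yρ + y < ρ³`.** [cite: MadrasSlade1993, §1.2 (elementary counting)] -/
theorem lvalid (hy : 0 < y) (hρ : 0 < ρ) (h : y * ρ + y < ρ ^ 3) : LValid y ρ (lvals y ρ) := by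
  have hρ2 : y < ρ ^ 2 := by nlinarith
  have hs : 0 < ρ ^ 2 - y := by linarith
  have hq : 0 < ρ ^ 3 - y * ρ - y := by linarith
  refine ⟨hy, hρ, by simp only [lvals]; positivity, by simp only [lvals]; positivity, by simp only [lvals]; positivity, by simp only [lvals]; positivity,
    by simp only [lvals]; positivity, by simp only [lvals]; exact hs, by simp only [lvals]; positivity, by simp only [lvals]; positivity,
    ?_, ?_, ?_, ?_, ?_, ?_, ?_, ?_⟩
  · simp only [lvals]; rw [div_mul_eq_div_div]; exact le_of_eq (by field_simp)
  · simp only [lvals]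
    have e : y * (2 * y / (ρ * (ρ ^ 2 - y))) + 2 * y / ρ = ρ * (2 * y / (ρ ^ 2 - y)) := by field_simp; ring
    exact e.le
  · simp only [lvals]; exact le_of_eq (by field_simp; ring)
  · simp only [lvals]; linarith
  · simp only [lvals]; nlinarith
  · simp only [lvals]; exact le_of_eq (by field_simp; ring)
  · simp only [lvals]; rw [div_le_iff₀ hρ]
    calc ρ ^ 3 - y * ρ - y = (ρ ^ 3 - y * ρ - y) / y * y := by field_simp
      _ ≤ (ρ ^ 3 - y * ρ - y) / y * ρ ^ 2 := mul_le_mul_of_nonneg_left hρ2.le (div_pos hq hy).le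
      _ = ρ * ((ρ ^ 3 - y * ρ - y) / y) * ρ := by ring
  · simp only [lvals]; exact le_of_eq (by field_simp)

/-- ★ **`μ_1(y,y) ≤ ρ` for every `ρ > 0` with `yρ + y < ρ³`** (all `y > 0`). [cite: BeatonBousquetMelouDeGierDuminilCopinGuttmann2014, §3.2 Proposition 6 (arXiv v5 p. 10); MadrasSlade1993, §8.2 (8.2.2)–(8.2.3)] -/
theorem stripMuY₂_one_self_le (hy : 0 < y) (hρ : 0 < ρ) (h : y * ρ + y < ρ ^ 3) : stripMuY₂ 1 y y ≤ ρ :=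
  stripMuY₂_one_self_le_of_valid (lvalid hy hρ h)

end LadderPot

open LadderPot in
/-- ★★★ **`μ_1(y,y)³ ≤ y·μ_1(y,y) + y`** for every `y > 0`: the width-one two-wall rate does not exceed the growth rate of the monotone
switch words.  (With the reverse inequality of `HexSAWBrickWallStripFugacityWidthOneCubic.lean`, `y ≥ 1`, this identifies `μ_1(y,y)`
as the unique positive root of `μ³ = yμ + y`.) [cite: BeatonBousquetMelouDeGierDuminilCopinGuttmann2014, §3.2 Proposition 6 (arXiv v5 p. 10) and §3.1 Proposition 5 (arXiv v5 p. 9: "zig-zag walks sticking to the surface"); MadrasSlade1993, §8.2] -/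
theorem stripMuY₂_one_self_pow_three_le (hy : 0 < y) : stripMuY₂ 1 y y ^ 3 ≤ y * stripMuY₂ 1 y y + y := by
  set μ := stripMuY₂ 1 y y with hμ
  by_contra hcon
  rw [not_le] at hcon
  -- the polynomial inequality `yρ + y < ρ³` is open: it holds at some `ρ < μ`
  have hμ0 : 0 < μ := stripMuY₂_pos 1 hy hy
  have hcont : ContinuousAt (fun ρ : ℝ => ρ ^ 3 - (y * ρ + y)) μ := by fun_prop
  have hev : ∀ᶠ ρ in 𝓝 μ, 0 < ρ ^ 3 - (y * ρ + y) ∧ 0 < ρ :=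
    (hcont.eventually (lt_mem_nhds (by linarith))).and (lt_mem_nhds hμ0)
  obtain ⟨ρ, ⟨hρ, hρ0⟩, hρμ⟩ := ((hev.filter_mono nhdsWithin_le_nhds).and (eventually_mem_nhdsWithin (s := Set.Iio μ))).exists
  rw [Set.mem_Iio] at hρμ
  have h3 : y * ρ + y < ρ ^ 3 := by linarith
  have := stripMuY₂_one_self_le hy hρ0 h3
  linarith

/-! ## Part C. The exact value: `μ_1(y,y)` is the positive root of `μ³ = yμ + y` -/

/-- ★★★ **`μ_1(y,y)³ = y·μ_1(y,y) + y` for every `y > 0`.** The width-one two-wall rate of the honeycomb strip is the unique positive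
root of the cubic `μ³ − yμ − y`; e.g. `μ_1(1,1)` (the connective constant of the one-cell strip) is the plastic number `1.3247…`.
[cite: BeatonBousquetMelouDeGierDuminilCopinGuttmann2014, §3.2 Proposition 6 (arXiv v5 p. 10: μ_T(y,z)); MadrasSlade1993, §8.2] -/
theorem stripMuY₂_one_self_pow_three_eq (hy : 0 < y) : stripMuY₂ 1 y y ^ 3 = y * stripMuY₂ 1 y y + y :=
  le_antisymm (stripMuY₂_one_self_pow_three_le hy) (mul_add_le_stripMuY₂_one_self_pow_three hy)

/-- **`μ_1(y,y)² = y + y/μ_1(y,y)`** (`y > 0`). [cite: BeatonBousquetMelouDeGierDuminilCopinGuttmann2014, §3.2 Proposition 6 (arXiv v5 p. 10)] -/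
theorem stripMuY₂_one_self_sq_eq (hy : 0 < y) : stripMuY₂ 1 y y ^ 2 = y + y / stripMuY₂ 1 y y := by
  have hμ := stripMuY₂_pos 1 hy hy
  have h := stripMuY₂_one_self_pow_three_eq hy
  field_simp
  linear_combination h

/-- **`y < μ_1(y,y)²`** (`y > 0`). [cite: BeatonBousquetMelouDeGierDuminilCopinGuttmann2014, §3.2 Proposition 6 (arXiv v5 p. 10)] -/
theorem lt_stripMuY₂_one_self_sq (hy : 0 < y) : y < stripMuY₂ 1 y y ^ 2 := by
  rw [stripMuY₂_one_self_sq_eq hy]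
  have := stripMuY₂_pos 1 hy hy
  linarith [div_pos hy this]

/-- **Uniqueness of the root**: any positive `ρ` with `ρ³ = yρ + y` equals `μ_1(y,y)`. [cite: BeatonBousquetMelouDeGierDuminilCopinGuttmann2014, §3.2 Proposition 6 (arXiv v5 p. 10)] -/
theorem stripMuY₂_one_self_eq_of_pow_three_eq (hy : 0 < y) {ρ : ℝ} (hρ : 0 < ρ) (h : ρ ^ 3 = y * ρ + y) : stripMuY₂ 1 y y = ρ := by
  set μ := stripMuY₂ 1 y y with hμdef
  have hμ : 0 < μ := stripMuY₂_pos 1 hy hy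
  have hμ3 := stripMuY₂_one_self_pow_three_eq hy
  have hμ2 : y < μ ^ 2 := lt_stripMuY₂_one_self_sq hy
  -- `(μ − ρ)(μ² + μρ + ρ² − y) = 0` with a positive second factor
  have e : (μ - ρ) * (μ ^ 2 + μ * ρ + ρ ^ 2 - y) = 0 := by linear_combination hμ3 - h
  rcases mul_eq_zero.1 e with h1 | h1
  · linarith
  · nlinarith [mul_pos hμ hρ, sq_nonneg ρ]

/-- ★ **The window `y + y/√(y+√y) ≤ μ_1(y,y)² ≤ y + √y`** for every `y > 0` (from `μ² = y + y/μ` and `√y < μ ≤ √(y+√y)`).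
[cite: BeatonBousquetMelouDeGierDuminilCopinGuttmann2014, §3.2 Proposition 6 (arXiv v5 p. 10) and §3.1 Proposition 5 (arXiv v5 p. 9: "zig-zag walks sticking to the surface")] -/
theorem stripMuY₂_one_self_sq_mem_Icc (hy : 0 < y) :
    stripMuY₂ 1 y y ^ 2 ∈ Set.Icc (y + y / Real.sqrt (y + Real.sqrt y)) (y + Real.sqrt y) := by
  have hμ := stripMuY₂_pos 1 hy hy
  have hsq := stripMuY₂_one_self_sq_eq hy
  have hlt := lt_stripMuY₂_one_self_sq hy
  have hs := Real.sqrt_pos.2 hy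
  have hsy : Real.sqrt y * Real.sqrt y = y := Real.mul_self_sqrt hy.le
  -- `√y < μ`
  have h1 : Real.sqrt y < stripMuY₂ 1 y y := by
    rw [← Real.sqrt_sq hμ.le]; exact Real.sqrt_lt_sqrt hy.le hlt
  -- hence `μ² ≤ y + √y`
  have hup : stripMuY₂ 1 y y ^ 2 ≤ y + Real.sqrt y := by
    rw [hsq, add_le_add_iff_left, div_le_iff₀ hμ]
    nlinarith
  refine ⟨?_, hup⟩
  -- and `μ ≤ √(y + √y)`, so `y/μ ≥ y/√(y+√y)`
  have h2 : stripMuY₂ 1 y y ≤ Real.sqrt (y + Real.sqrt y) := by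
    rw [← Real.sqrt_sq hμ.le]; exact Real.sqrt_le_sqrt hup
  rw [hsq, add_le_add_iff_left]
  exact div_le_div_of_nonneg_left hy.le hμ h2

/-- `μ_T(1,1)` of the printed two-fugacity model is the strip connective constant `μ(S_T)`. [cite: BeatonBousquetMelouDeGierDuminilCopinGuttmann2014, §3.2 Proposition 6 (arXiv v5 p. 10); MadrasSlade1993, §8.2, eq. (8.2.3)] -/
theorem stripMuY₂_one_one_one (T : ℕ) : stripMuY₂ T 1 1 = stripConnectiveConstant T := by
  rw [stripMuY₂_one_right]
  unfold stripMuY₀ stripConnectiveConstant stripZ₀ stripCount yK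
  simp

/-- ★ **The connective constant of the one-cell honeycomb strip is the plastic number**: `μ(S_1)³ = μ(S_1) + 1` (the walk-rate
form of the printed bridge-series denominator `1 − 2z² + z⁴ − z⁶ = (1−z²−z³)(1−z²+z³)` of this strip, tree `BGJ12.den_one_factor`).
[cite: MadrasSlade1993, §8.2, eq. (8.2.3); BeatonGuttmannJensen2012, §2 p. 4 (arXiv pagination: B_1(z), "simple poles"); BeatonBousquetMelouDeGierDuminilCopinGuttmann2014, §3.2 Proposition 6 (arXiv v5 p. 10)] -/
theorem stripConnectiveConstant_one_pow_three : stripConnectiveConstant 1 ^ 3 = stripConnectiveConstant 1 + 1 := by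
  rw [← stripMuY₂_one_one_one]
  have h := stripMuY₂_one_self_pow_three_eq (y := 1) one_pos
  simpa using h

/-- `1.3247 < μ(S_1) < 1.3248`. [cite: MadrasSlade1993, §8.2, eq. (8.2.3); BeatonGuttmannJensen2012, §2 p. 4 (arXiv pagination: the dominant pole z_c(T))] -/
theorem stripConnectiveConstant_one_mem_Ioo : stripConnectiveConstant 1 ∈ Set.Ioo (1.3247 : ℝ) 1.3248 := by
  have h := stripConnectiveConstant_one_pow_three
  have h0 : 0 < stripConnectiveConstant 1 := by rw [← stripMuY₂_one_one_one]; exact stripMuY₂_pos 1 one_pos one_pos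
  set μ := stripConnectiveConstant 1
  have h1 : 1 < μ := by nlinarith [sq_nonneg μ, sq_nonneg (μ - 1)]
  constructor
  · by_contra hc
    rw [not_lt] at hc
    nlinarith [mul_nonneg (show (0:ℝ) ≤ 1.3247 - μ by linarith) (show (0:ℝ) ≤ μ ^ 2 + μ * 1.3247 + 1.3247 ^ 2 - 1 by nlinarith)]
  · by_contra hc
    rw [not_lt] at hc
    nlinarith [mul_nonneg (show (0:ℝ) ≤ μ - 1.3248 by linarith) (show (0:ℝ) ≤ μ ^ 2 + μ * 1.3248 + 1.3248 ^ 2 - 1 by nlinarith)]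

/-! ## Part D. The width-one slit tops the two-wall tower from `y ≥ 9` on -/

/-- ★★ **`μ_T(y,y) < μ_1(y,y)` for every `T ≥ 2` and every `y ≥ 9`** (the previous file `…TwoWallOrder` had `y ≥ 25`): by its uniform
window `μ_T(y,y)² ≤ y + 4/(√y − 1)` and the exact lower value `y + y/√(y+√y) ≤ μ_1(y,y)²`.
[cite: BeatonBousquetMelouDeGierDuminilCopinGuttmann2014, §3.2 Propositions 6–7 (arXiv v5 pp. 10–11)] -/
theorem stripMuY₂_self_lt_one_of_nine_le {T : ℕ} (hT : 2 ≤ T) (hy : 9 ≤ y) : stripMuY₂ T y y < stripMuY₂ 1 y y := by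
  have hy0 : 0 < y := by linarith
  have hT' := stripMuY₂_self_sq_le_of_two_le hT (by linarith : (4:ℝ) ≤ y)
  have h1 := (stripMuY₂_one_self_sq_mem_Icc hy0).1
  have hμT := stripMuY₂_pos T hy0 hy0
  have hμ1 := stripMuY₂_pos 1 hy0 hy0
  -- `4/(√y − 1) < y/√(y + √y)`
  set s := Real.sqrt y with hs
  have hs3 : 3 ≤ s := by
    rw [hs, show (3:ℝ) = Real.sqrt 9 by rw [show (9:ℝ) = 3 ^ 2 by norm_num, Real.sqrt_sq (by norm_num : (0:ℝ) ≤ 3)]]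
    exact Real.sqrt_le_sqrt hy
  have hsy : s * s = y := by rw [hs]; exact Real.mul_self_sqrt hy0.le
  have hr0 : 0 < Real.sqrt (y + s) := Real.sqrt_pos.2 (by linarith)
  have hr2 : Real.sqrt (y + s) * Real.sqrt (y + s) = y + s := Real.mul_self_sqrt (by linarith)
  have key : 4 / (s - 1) < y / Real.sqrt (y + s) := by
    rw [div_lt_div_iff₀ (by linarith) hr0]
    -- square both sides: `16 (y + s) < y² (s − 1)²`
    have hpos : 0 < y * (s - 1) := mul_pos hy0 (by linarith)
    have hsq : (4 * Real.sqrt (y + s)) ^ 2 < (y * (s - 1)) ^ 2 := by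
      have e1 : (4 * Real.sqrt (y + s)) ^ 2 = 16 * (y + s) := by nlinarith [hr2]
      rw [e1]
      have h36 : 36 * y ≤ y ^ 2 * (s - 1) ^ 2 := by
        have : (4:ℝ) ≤ (s - 1) ^ 2 := by nlinarith
        have : 9 * y ≤ y ^ 2 := by nlinarith
        nlinarith
      nlinarith
    exact lt_of_pow_lt_pow_left₀ 2 hpos.le hsq
  have hlt : stripMuY₂ T y y ^ 2 < stripMuY₂ 1 y y ^ 2 := by linarith
  exact lt_of_pow_lt_pow_left₀ 2 hμ1.le hlt

end Literature.Probability.RandomPlanarGeometry.SAW.HexBW
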